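import Literature.Combinatorics.Optimization.FixedSizePsdRankCorrelationPolytope
import Literature.Combinatorics.Optimization.PsdLiftSlackMatrix
import HarnessLib

/-!
# `(S^d_+)^r`-lifts give `(S^d_+)^r`-factorizations of slack matrices (Fawzi–Parrilo 2013, Thm. 2, the
# direction used), and FP13 Theorem 1 in lift form

H. Fawzi, P. A. Parrilo, *Exponential lower bounds on fixed-size psd rank and semidefinite extension
complexity*, arXiv:1311.2571 [cite: FawziParrilo2013]; J. Gouveia, P. A. Parrilo, R. R. Thomas, *Lifts of
convex sets and cone factorizations*, Math. Oper. Res. 38 (2013) [cite: GouveiaParriloThomas2013].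
Everything here is PROVED; no facts are asserted.

* `HasBlockPsdLift C d r` — "`P` has a `K`-lift where `K = S^d_+ × ⋯ × S^d_+` if `P = π(K ∩ L)` where `L`
  is an affine subspace and `π` a linear map" (FP13 §1 p. 2; "(S^d_+)^r-lift", §1.2 p. 4): the fixed-block-size
  companion of the tree's `HasPsdLift C k` (`PsdLiftSlackMatrix.lean`). `d = 1`: LP lifts; `d = 2`:
  second-order-cone lifts (FP13 p. 4).
* `BlockPsdLift.embed` / `extract` — the block-diagonal embedding `(S^d_+)^r ⊆ S^{dr}_+` (§1.1 p. 3) as a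
  linear map with its left inverse; `posSemidef_embed_iff`, `trace_mul_embed` (`⟨U, diag M_t⟩ = Σ_t ⟨U_tt, M_t⟩`).
* `BlockPsdLift.exists_block_certificate` — conic duality on `(S^d_+)^r ∩ L` WITHOUT a Slater point:
  a linear functional bounded by `β` there satisfies `β − g(M) = Σ_t ⟨U_t, M_t⟩ + μ`, `U_t ⪰ 0`, `μ ≥ 0`
  (reduction through `embed` to the tree's facial-reduction certificate
  `exists_posSemidef_certificate_of_le_on_psdLift`).
* `HasBlockPsdLift.hasPsdPowerFactorization_slack` — **FP13 Thm. 2 (= GPT Thm. 2.4), the direction "lift ⇒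
  factorization"**, typed Slater-free, for a BOUNDED lifted set and ARBITRARY families of points of `C` and of
  valid inequalities: the slack matrix `(b_j − a_jᵀx_i)` has an `(S^d_+)^r`-factorization
  (`FixedSizePsdRank.HasPsdPowerFactorization`, from `FixedSizePsdRankCorrelationPolytope.lean`). The constants
  `μ_j` of the certificates are absorbed by an `E ⪰ 0` with `Σ_t ⟨E_t, M_t⟩ = 1` on the lift, built from the
  certificates of `±(πM₁ − πM₂)ᵀ y` for two points of `C` — so, unlike the tree's one-block
  `HasPsdLift.hasPsdFactorization_pairSlackMatrix`, no LP duality / finiteness of the inequality system is needed,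
  only boundedness of `C`.
* `FixedSizePsdRank.corPolytope n = conv{aaᵀ : a ∈ {0,1}ⁿ} ⊂ ℝ^{n×n}` (flattened to `ℝ^{n²}`, `vecOuter`, `flat`),
  `hasPsdPowerFactorization_corrSlack_of_lift` (a lift of `COR(n)` factorizes its full slack matrix `corrSlack n`),
  and **FP13 Theorem 1 in the printed lift form**: `FawziParrilo2013_thm1_lift` (`(S^d_+)^r`-lift of `COR(n)`,
  `n ≥ d ≥ 1` ⇒ `κ(d)c(d)ⁿ ≤ r`, via `FawziParrilo2013_thm1_holds`) and `FawziParrilo2013_thm1_lift_two`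
  (`d = 2`: `(1/√7)(√(9/7))ⁿ ≤ r`).

* `HasBlockPsdLift.hasPsdLift` — "any `(S^d_+)^r`-lift is an `S^{rd}_+`-lift" (§1.1 p. 3), and
  `posSemidef_lorentz_two_iff` — `S²_+ ≅ L²` (p. 4: `(S²_+)^r`-lifts are second-order-cone programs).
* Closure properties: `HasBlockPsdLift.mono_blocks` (more blocks), `.mono_size` (bigger blocks), `.prod` / `.add` /
  `.inter` (products, Minkowski sums, intersections: `r₁ + r₂` blocks), `.vadd` (translates of bounded sets),
  `HasBlockPsdLift.image` (linear images / projections), `.inter_affineSubspace` (sections,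
  in particular faces), `hasBlockPsdLift_one_iff` (`(S^d_+)^1`-lifts = the tree's `HasPsdLift C d`); and the LP case
  `FawziParrilo2013_thm1_lift_one` (`(S^1_+)^r`-lift of `COR(n)` ⇒ `(3/2)ⁿ ≤ r`).

* The converse direction (GPT Thm. 2.4, "factorization ⇒ lift", block version of the tree's
  `HasPsdFactorization.exists_hasPsdLift_between`): `HasPsdPowerFactorization.exists_hasBlockPsdLift_between`
  (a sandwiched `(S^d_+)^r`-lift `conv(x_i) ⊆ C ⊆ Q` from a factorization, `Q` bounded), with
  `hasBlockPsdLift_empty` / `hasBlockPsdLift_singleton`; hence the EQUIVALENCE for polytopes with both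
  descriptions, `hasPsdPowerFactorization_slack_iff_hasBlockPsdLift` (GPT Thm. 2.4 / FP13 Thm. 2 for `(S^d_+)^r`), and
  the pair form `hasPsdPowerFactorization_slack_iff_exists_between` (FGPRT Thm. 3.3 for `P ⊆ Q`); the trivial lifts
  `hasBlockPsdLift_convexHull_range_one` (an `(S^1_+)^v`-lift of a polytope with `v` vertices, through the simplex),
  `hasBlockPsdLift_one_card_inequalities` (an `(S^1_+)^f`-lift from `f` inequalities) and `hasPsdLift_convexHull_range_card`.
-/

noncomputable section

open Finset Matrix
open scoped MatrixOrder

namespace Literature.Combinatorics.Optimization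

/-- **`(S^d_+)^r`-lift** of a set `C`: `C = π(K ∩ L)` with `K = S^d_+ × ⋯ × S^d_+` (`r` copies), `L` an
affine subspace and `π` a linear map — "an SDP lift over `r` psd blocks of the fixed size `d`" (`d = 1`: LP
lifts, `d = 2`: second-order-cone lifts). The tree's `HasPsdLift C k` is the one-block case `K = S^k_+`.
[cite: FawziParrilo2013, §1 (p. 2, "P = π(K ∩ L) where K = S^d_+ × ⋯ × S^d_+") and §1.2 (p. 4, "(S^d_+)^r-lift")] -/
def HasBlockPsdLift {E : Type*} [AddCommGroup E] [Module ℝ E] (C : Set E) (d r : ℕ) : Prop :=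
  ∃ (L : AffineSubspace ℝ (Fin r → Matrix (Fin d) (Fin d) ℝ))
    (π : (Fin r → Matrix (Fin d) (Fin d) ℝ) →ₗ[ℝ] E),
    C = π '' {M | (∀ t, (M t).PosSemidef) ∧ M ∈ L}

/-! ### Closure properties of `(S^d_+)^r`-lifts -/

/-- Linear images (projections) of a lifted set are lifted with the same cone: compose `π`.
[cite: GouveiaParriloThomas2013, Def. 2.2 (§2)] [cite: FawziParrilo2013, §1 (p. 2)] -/
theorem HasBlockPsdLift.image {E E' : Type*} [AddCommGroup E] [Module ℝ E] [AddCommGroup E'] [Module ℝ E']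
    {C : Set E} {d r : ℕ} (h : HasBlockPsdLift C d r) (f : E →ₗ[ℝ] E') :
    HasBlockPsdLift (f '' C) d r := by
  obtain ⟨L, π, rfl⟩ := h
  exact ⟨L, f ∘ₗ π, by rw [Set.image_image]; rfl⟩

/-- Sections by affine subspaces (in particular faces `C ∩ {y : aᵀy = b}` cut out by a valid inequality) are
lifted with the same cone: intersect `L` with `π⁻¹(S)`. [cite: GouveiaParriloThomas2013, Def. 2.2 (§2)]
[cite: FawziParrilo2013, §1.2 (p. 4, "the correlation polytope projects onto a face of the TSP polytope")] -/
theorem HasBlockPsdLift.inter_affineSubspace {E : Type*} [AddCommGroup E] [Module ℝ E] {C : Set E} {d r : ℕ}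
    (h : HasBlockPsdLift C d r) (S : AffineSubspace ℝ E) : HasBlockPsdLift (C ∩ (S : Set E)) d r := by
  obtain ⟨L, π, rfl⟩ := h
  refine ⟨L ⊓ S.comap π.toAffineMap, π, ?_⟩
  ext y
  constructor
  · rintro ⟨⟨M, ⟨hM, hML⟩, rfl⟩, hyS⟩
    exact ⟨M, ⟨hM, (AffineSubspace.mem_inf_iff _ _ _).2 ⟨hML, AffineSubspace.mem_comap.2 hyS⟩⟩, rfl⟩
  · rintro ⟨M, ⟨hM, hML⟩, rfl⟩
    obtain ⟨h1, h2⟩ := (AffineSubspace.mem_inf_iff _ _ _).1 hML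
    exact ⟨⟨M, ⟨hM, h1⟩, rfl⟩, AffineSubspace.mem_comap.1 h2⟩

/-- More blocks: an `(S^d_+)^r`-lift is an `(S^d_+)^s`-lift for `r ≤ s` (append blocks constrained to `0`), so
"the smallest `r`" is well behaved. [cite: GouveiaParriloThomas2013, Def. 2.2 (§2)] [cite: FawziParrilo2013, §1.2 (p. 4)] -/
theorem HasBlockPsdLift.mono_blocks {E : Type*} [AddCommGroup E] [Module ℝ E] {C : Set E} {d r s : ℕ}
    (h : HasBlockPsdLift C d r) (hrs : r ≤ s) : HasBlockPsdLift C d s := by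
  obtain ⟨e, rfl⟩ := Nat.exists_eq_add_of_le hrs
  obtain ⟨L, π, rfl⟩ := h
  let ext0 : (Fin r → Matrix (Fin d) (Fin d) ℝ) →ₗ[ℝ] (Fin (r + e) → Matrix (Fin d) (Fin d) ℝ) :=
    { toFun := fun M => Fin.append M (fun _ => (0 : Matrix (Fin d) (Fin d) ℝ))
      map_add' := fun M N => by
        funext t
        refine Fin.addCases (fun i => ?_) (fun i => ?_) t
        · simp only [Pi.add_apply, Fin.append_left]
        · simp only [Pi.add_apply, Fin.append_right, add_zero]
      map_smul' := fun c M => by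
        funext t
        refine Fin.addCases (fun i => ?_) (fun i => ?_) t
        · simp only [Pi.smul_apply, Fin.append_left, RingHom.id_apply]
        · simp only [Pi.smul_apply, Fin.append_right, smul_zero, RingHom.id_apply] }
  let restr : (Fin (r + e) → Matrix (Fin d) (Fin d) ℝ) →ₗ[ℝ] (Fin r → Matrix (Fin d) (Fin d) ℝ) :=
    { toFun := fun N t => N (Fin.castAdd e t)
      map_add' := fun _ _ => rfl
      map_smul' := fun _ _ => rfl }
  have hext : ∀ M t, ext0 M t = Fin.append M (fun _ => (0 : Matrix (Fin d) (Fin d) ℝ)) t := fun M t => rfl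
  have hre : ∀ M, restr (ext0 M) = M := fun M => funext fun t => by
    change ext0 M (Fin.castAdd e t) = M t
    rw [hext, Fin.append_left]
  refine ⟨L.map ext0.toAffineMap, π ∘ₗ restr, ?_⟩
  ext y
  constructor
  · rintro ⟨M, ⟨hM, hML⟩, rfl⟩
    refine ⟨ext0 M, ⟨fun t => ?_, AffineSubspace.mem_map.2 ⟨M, hML, rfl⟩⟩, ?_⟩
    · refine Fin.addCases (fun i => ?_) (fun i => ?_) t
      · rw [hext, Fin.append_left]; exact hM i
      · rw [hext, Fin.append_right]; exact Matrix.PosSemidef.zero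
    · change π (restr (ext0 M)) = π M
      rw [hre]
  · rintro ⟨N, ⟨hN, hNL⟩, rfl⟩
    obtain ⟨M, hML, rfl⟩ := AffineSubspace.mem_map.1 hNL
    refine ⟨M, ⟨fun t => ?_, hML⟩, ?_⟩
    · have := hN (Fin.castAdd e t)
      change (ext0 M (Fin.castAdd e t)).PosSemidef at this
      rwa [hext, Fin.append_left] at this
    · change π M = π (restr (ext0 M))
      rw [hre]

open Literature.Analysis.Convex (selMatrix padMatrix padMatrix_apply posSemidef_padMatrix_iff
  selMatrix_transpose_mul_self) in
/-- Bigger blocks: an `(S^d_+)^r`-lift is an `(S^{d'}_+)^r`-lift for `d ≤ d'` (pad every block by zeros, as the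
tree's `HasPsdLift.mono`; `S^d_+` is a face of `S^{d'}_+`). [cite: GouveiaParriloThomas2013, Def. 2.2 (§2)]
[cite: FawziParrilo2013, §1.1 (p. 3)] -/
theorem HasBlockPsdLift.mono_size {E : Type*} [AddCommGroup E] [Module ℝ E] {C : Set E} {d d' r : ℕ}
    (h : HasBlockPsdLift C d r) (hd : d ≤ d') : HasBlockPsdLift C d' r := by
  classical
  obtain ⟨L, π, rfl⟩ := h
  let e : Fin d → Fin d' := Fin.castLE hd
  have he : Function.Injective e := Fin.castLE_injective hd
  let emb : (Fin r → Matrix (Fin d) (Fin d) ℝ) →ₗ[ℝ] (Fin r → Matrix (Fin d') (Fin d') ℝ) :=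
    { toFun := fun M t => padMatrix e (M t)
      map_add' := fun M N => funext fun t => by simp only [Pi.add_apply, map_add]
      map_smul' := fun c M => funext fun t => by simp only [Pi.smul_apply, map_smul, RingHom.id_apply] }
  let proj : (Fin r → Matrix (Fin d') (Fin d') ℝ) →ₗ[ℝ] (Fin r → Matrix (Fin d) (Fin d) ℝ) :=
    { toFun := fun N t => (selMatrix e)ᵀ * N t * selMatrix e
      map_add' := fun N N' => funext fun t => by simp only [Pi.add_apply, Matrix.mul_add, Matrix.add_mul]
      map_smul' := fun c N => funext fun t => by
        simp only [Pi.smul_apply, Matrix.mul_smul, Matrix.smul_mul, RingHom.id_apply] }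
  have hemb : ∀ M t, emb M t = padMatrix e (M t) := fun M t => rfl
  have hpe : ∀ M, proj (emb M) = M := by
    intro M
    funext t
    change (selMatrix e)ᵀ * padMatrix e (M t) * selMatrix e = M t
    rw [padMatrix_apply]
    calc (selMatrix e)ᵀ * (selMatrix e * M t * (selMatrix e)ᵀ) * selMatrix e
        = ((selMatrix e)ᵀ * selMatrix e) * M t * ((selMatrix e)ᵀ * selMatrix e) := by
          simp only [Matrix.mul_assoc]
      _ = M t := by rw [selMatrix_transpose_mul_self he, Matrix.one_mul, Matrix.mul_one]
  refine ⟨L.map emb.toAffineMap, π ∘ₗ proj, ?_⟩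
  ext y
  constructor
  · rintro ⟨M, ⟨hM, hML⟩, rfl⟩
    refine ⟨emb M, ⟨fun t => ?_, AffineSubspace.mem_map.2 ⟨M, hML, rfl⟩⟩, ?_⟩
    · rw [hemb]; exact (posSemidef_padMatrix_iff he).mpr (hM t)
    · change π (proj (emb M)) = π M
      rw [hpe]
  · rintro ⟨N, ⟨hN, hNL⟩, rfl⟩
    obtain ⟨M, hML, rfl⟩ := AffineSubspace.mem_map.1 hNL
    refine ⟨M, ⟨fun t => ?_, hML⟩, ?_⟩
    · have : (emb M t).PosSemidef := hN t
      rw [hemb] at this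
      exact (posSemidef_padMatrix_iff he).mp this
    · change π M = π (proj (emb M))
      rw [hpe]

/-- **Products**: `(S^d_+)^{r₁}`- and `(S^d_+)^{r₂}`-lifts of `C₁`, `C₂` give an `(S^d_+)^{r₁+r₂}`-lift of
`C₁ × C₂` (`K₁ × K₂`-lift of a product). [cite: GouveiaParriloThomas2013, Def. 2.2 (§2)] -/
theorem HasBlockPsdLift.prod {E₁ E₂ : Type*} [AddCommGroup E₁] [Module ℝ E₁] [AddCommGroup E₂] [Module ℝ E₂]
    {C₁ : Set E₁} {C₂ : Set E₂} {d r₁ r₂ : ℕ} (h₁ : HasBlockPsdLift C₁ d r₁) (h₂ : HasBlockPsdLift C₂ d r₂) :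
    HasBlockPsdLift (C₁ ×ˢ C₂) d (r₁ + r₂) := by
  obtain ⟨L₁, π₁, rfl⟩ := h₁
  obtain ⟨L₂, π₂, rfl⟩ := h₂
  let ρ₁ : (Fin (r₁ + r₂) → Matrix (Fin d) (Fin d) ℝ) →ₗ[ℝ] (Fin r₁ → Matrix (Fin d) (Fin d) ℝ) :=
    { toFun := fun M t => M (Fin.castAdd r₂ t), map_add' := fun _ _ => rfl, map_smul' := fun _ _ => rfl }
  let ρ₂ : (Fin (r₁ + r₂) → Matrix (Fin d) (Fin d) ℝ) →ₗ[ℝ] (Fin r₂ → Matrix (Fin d) (Fin d) ℝ) :=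
    { toFun := fun M t => M (Fin.natAdd r₁ t), map_add' := fun _ _ => rfl, map_smul' := fun _ _ => rfl }
  have hρ₁ : ∀ M₁ M₂, ρ₁ (Fin.append M₁ M₂) = M₁ := fun M₁ M₂ => funext fun t => by
    change Fin.append M₁ M₂ (Fin.castAdd r₂ t) = M₁ t; rw [Fin.append_left]
  have hρ₂ : ∀ M₁ M₂, ρ₂ (Fin.append M₁ M₂) = M₂ := fun M₁ M₂ => funext fun t => by
    change Fin.append M₁ M₂ (Fin.natAdd r₁ t) = M₂ t; rw [Fin.append_right]
  have happ : ∀ M : Fin (r₁ + r₂) → Matrix (Fin d) (Fin d) ℝ, Fin.append (ρ₁ M) (ρ₂ M) = M := fun M => by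
    funext t
    refine Fin.addCases (fun i => ?_) (fun i => ?_) t
    · rw [Fin.append_left]; rfl
    · rw [Fin.append_right]; rfl
  refine ⟨L₁.comap ρ₁.toAffineMap ⊓ L₂.comap ρ₂.toAffineMap, (π₁ ∘ₗ ρ₁).prod (π₂ ∘ₗ ρ₂), ?_⟩
  ext ⟨y₁, y₂⟩
  constructor
  · rintro ⟨⟨M₁, ⟨hM₁, hM₁L⟩, rfl⟩, ⟨M₂, ⟨hM₂, hM₂L⟩, rfl⟩⟩
    refine ⟨Fin.append M₁ M₂, ⟨fun t => ?_, (AffineSubspace.mem_inf_iff _ _ _).2 ⟨?_, ?_⟩⟩, ?_⟩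
    · refine Fin.addCases (fun i => ?_) (fun i => ?_) t
      · rw [Fin.append_left]; exact hM₁ i
      · rw [Fin.append_right]; exact hM₂ i
    · exact AffineSubspace.mem_comap.2 (by change ρ₁ (Fin.append M₁ M₂) ∈ L₁; rw [hρ₁]; exact hM₁L)
    · exact AffineSubspace.mem_comap.2 (by change ρ₂ (Fin.append M₁ M₂) ∈ L₂; rw [hρ₂]; exact hM₂L)
    · change (π₁ (ρ₁ (Fin.append M₁ M₂)), π₂ (ρ₂ (Fin.append M₁ M₂))) = (π₁ M₁, π₂ M₂)
      rw [hρ₁, hρ₂]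
  · rintro ⟨M, ⟨hM, hML⟩, hMy⟩
    obtain ⟨h1, h2⟩ := (AffineSubspace.mem_inf_iff _ _ _).1 hML
    have e1 : π₁ (ρ₁ M) = y₁ := congrArg Prod.fst hMy
    have e2 : π₂ (ρ₂ M) = y₂ := congrArg Prod.snd hMy
    refine ⟨⟨ρ₁ M, ⟨fun t => hM _, AffineSubspace.mem_comap.1 h1⟩, e1⟩,
      ⟨ρ₂ M, ⟨fun t => hM _, AffineSubspace.mem_comap.1 h2⟩, e2⟩⟩

open scoped Pointwise in
/-- **Minkowski sums**: `C₁ + C₂` has an `(S^d_+)^{r₁+r₂}`-lift (image of the product under addition).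
[cite: GouveiaParriloThomas2013, Def. 2.2 (§2)] -/
theorem HasBlockPsdLift.add {E : Type*} [AddCommGroup E] [Module ℝ E] {C₁ C₂ : Set E} {d r₁ r₂ : ℕ}
    (h₁ : HasBlockPsdLift C₁ d r₁) (h₂ : HasBlockPsdLift C₂ d r₂) : HasBlockPsdLift (C₁ + C₂) d (r₁ + r₂) := by
  have h := (h₁.prod h₂).image (LinearMap.fst ℝ E E + LinearMap.snd ℝ E E)
  have hset : (LinearMap.fst ℝ E E + LinearMap.snd ℝ E E) '' (C₁ ×ˢ C₂) = C₁ + C₂ := by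
    ext y
    simp only [Set.mem_image, Set.mem_prod, LinearMap.add_apply, LinearMap.fst_apply, LinearMap.snd_apply,
      Set.mem_add, Prod.exists]
    constructor
    · rintro ⟨a, b, ⟨ha, hb⟩, rfl⟩; exact ⟨a, ha, b, hb, rfl⟩
    · rintro ⟨a, ha, b, hb, rfl⟩; exact ⟨a, b, ⟨ha, hb⟩, rfl⟩
  rwa [hset] at h

/-- **Intersections**: `C₁ ∩ C₂` has an `(S^d_+)^{r₁+r₂}`-lift (the product lift cut by the diagonal).
[cite: GouveiaParriloThomas2013, Def. 2.2 (§2)] -/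
theorem HasBlockPsdLift.inter {E : Type*} [AddCommGroup E] [Module ℝ E] {C₁ C₂ : Set E} {d r₁ r₂ : ℕ}
    (h₁ : HasBlockPsdLift C₁ d r₁) (h₂ : HasBlockPsdLift C₂ d r₂) : HasBlockPsdLift (C₁ ∩ C₂) d (r₁ + r₂) := by
  -- the diagonal `{(y, y)}` as an affine subspace of `E × E`
  let Δ : AffineSubspace ℝ (E × E) := (LinearMap.ker (LinearMap.fst ℝ E E - LinearMap.snd ℝ E E)).toAffineSubspace
  have h := ((h₁.prod h₂).inter_affineSubspace Δ).image (LinearMap.fst ℝ E E)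
  have hΔ : ∀ p : E × E, p ∈ (Δ : Set (E × E)) ↔ p.1 = p.2 := by
    intro p
    change p ∈ Δ ↔ _
    rw [Submodule.mem_toAffineSubspace, LinearMap.mem_ker, LinearMap.sub_apply, LinearMap.fst_apply,
      LinearMap.snd_apply, sub_eq_zero]
  have hset : (LinearMap.fst ℝ E E) '' (C₁ ×ˢ C₂ ∩ (Δ : Set (E × E))) = C₁ ∩ C₂ := by
    ext y
    constructor
    · rintro ⟨⟨a, b⟩, ⟨⟨ha, hb⟩, hab⟩, rfl⟩
      have hab' : a = b := (hΔ (a, b)).1 hab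
      exact ⟨ha, by rw [LinearMap.fst_apply, hab']; exact hb⟩
    · rintro ⟨h1, h2⟩
      exact ⟨(y, y), ⟨⟨h1, h2⟩, (hΔ (y, y)).2 rfl⟩, rfl⟩
  rwa [hset] at h

/-- **One block: `(S^d_+)^1`-lifts are the tree's psd lifts of size `d`** (`HasPsdLift`, FGPRT eq. (3)).
[cite: FawziParrilo2013, §1.1 (p. 3)] [cite: FawziEtAl2015, §3.1 eq. (3) (p09)] -/
theorem hasBlockPsdLift_one_iff {E : Type*} [AddCommGroup E] [Module ℝ E] {C : Set E} {d : ℕ} :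
    HasBlockPsdLift C d 1 ↔ HasPsdLift C d := by
  let e : (Fin 1 → Matrix (Fin d) (Fin d) ℝ) ≃ₗ[ℝ] Matrix (Fin d) (Fin d) ℝ :=
    LinearEquiv.funUnique (Fin 1) ℝ (Matrix (Fin d) (Fin d) ℝ)
  have he : ∀ M : Fin 1 → Matrix (Fin d) (Fin d) ℝ, e M = M 0 := fun M => rfl
  have hes : ∀ (N : Matrix (Fin d) (Fin d) ℝ) (t : Fin 1), e.symm N t = N := fun N t => rfl
  constructor
  · rintro ⟨L, π, rfl⟩
    refine ⟨L.map e.toLinearMap.toAffineMap, π ∘ₗ e.symm.toLinearMap, ?_⟩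
    ext y
    constructor
    · rintro ⟨M, ⟨hM, hML⟩, rfl⟩
      refine ⟨e M, ⟨by rw [he]; exact hM 0, AffineSubspace.mem_map.2 ⟨M, hML, rfl⟩⟩, ?_⟩
      change π (e.symm (e M)) = π M
      rw [e.symm_apply_apply]
    · rintro ⟨N, ⟨hN, hNL⟩, rfl⟩
      obtain ⟨M, hML, hMN⟩ := AffineSubspace.mem_map.1 hNL
      refine ⟨M, ⟨fun t => ?_, hML⟩, ?_⟩
      · have : M t = N := by rw [← hMN, Subsingleton.elim t 0]; rfl
        rw [this]; exact hN
      · change π M = π (e.symm N)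
        rw [← hMN]
        change π M = π (e.symm (e M))
        rw [e.symm_apply_apply]
  · rintro ⟨L, π, rfl⟩
    refine ⟨L.map e.symm.toLinearMap.toAffineMap, π ∘ₗ e.toLinearMap, ?_⟩
    ext y
    constructor
    · rintro ⟨N, ⟨hN, hNL⟩, rfl⟩
      refine ⟨e.symm N, ⟨fun t => by rw [hes]; exact hN, AffineSubspace.mem_map.2 ⟨N, hNL, rfl⟩⟩, ?_⟩
      change π (e (e.symm N)) = π N
      rw [e.apply_symm_apply]
    · rintro ⟨M, ⟨hM, hML⟩, rfl⟩
      obtain ⟨N, hNL, hNM⟩ := AffineSubspace.mem_map.1 hML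
      refine ⟨N, ⟨?_, hNL⟩, ?_⟩
      · have : N = M 0 := by rw [← hNM]; rfl
        rw [this]; exact hM 0
      · change π N = π (e M)
        rw [← hNM]
        change π N = π (e (e.symm N))
        rw [e.apply_symm_apply]

namespace BlockPsdLift

variable {d r : ℕ}

/-! ### The block-diagonal embedding `(S^d_+)^r ⊆ S^{dr}_+` as a linear map, and its left inverse -/

/-- `M = (M_1, …, M_r) ↦ diag(M_1, …, M_r) ∈ ℝ^{dr × dr}`. [cite: FawziParrilo2013, §1.1 (p. 3, "(S^d_+)^r ⊆ S^{rd}_+")] -/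
def embed (d r : ℕ) : (Fin r → Matrix (Fin d) (Fin d) ℝ) →ₗ[ℝ] Matrix (Fin (d * r)) (Fin (d * r)) ℝ where
  toFun M := (blockDiagonal M).submatrix finProdFinEquiv.symm finProdFinEquiv.symm
  map_add' M N := by
    ext i j
    simp only [submatrix_apply, Matrix.add_apply, blockDiagonal_add]
  map_smul' c M := by
    ext i j
    simp only [submatrix_apply, Matrix.smul_apply, blockDiagonal_smul, RingHom.id_apply]

/-- The diagonal blocks of a `dr × dr` matrix. [cite: FawziParrilo2013, §1.1 (p. 3)] -/
def extract (d r : ℕ) : Matrix (Fin (d * r)) (Fin (d * r)) ℝ →ₗ[ℝ] (Fin r → Matrix (Fin d) (Fin d) ℝ) where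
  toFun N := fun t => Matrix.of fun i j => N (finProdFinEquiv (i, t)) (finProdFinEquiv (j, t))
  map_add' N N' := by funext t; ext i j; rfl
  map_smul' c N := by funext t; ext i j; rfl

/-- `extract ∘ embed = id`. [cite: FawziParrilo2013, §1.1 (p. 3)] -/
theorem extract_embed (M : Fin r → Matrix (Fin d) (Fin d) ℝ) : extract d r (embed d r M) = M := by
  funext t
  ext i j
  simp [extract, embed, blockDiagonal_apply_eq]

/-- `diag(M_t)` is psd iff every block is. [cite: FawziParrilo2013, §1.1 (p. 3)] -/
theorem posSemidef_embed_iff (M : Fin r → Matrix (Fin d) (Fin d) ℝ) :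
    (embed d r M).PosSemidef ↔ ∀ t, (M t).PosSemidef := by
  change ((blockDiagonal M).submatrix _ _).PosSemidef ↔ _
  rw [Matrix.posSemidef_submatrix_equiv]
  exact Literature.Analysis.Convex.FrictionConeLMI.posSemidef_blockDiagonal_iff M

/-- Diagonal blocks of a psd matrix are psd. [cite: FawziParrilo2013, §1.1 (p. 3)] -/
theorem posSemidef_extract {N : Matrix (Fin (d * r)) (Fin (d * r)) ℝ} (hN : N.PosSemidef) (t : Fin r) :
    (extract d r N t).PosSemidef := by
  change (N.submatrix (fun i => finProdFinEquiv (i, t)) (fun i => finProdFinEquiv (i, t))).PosSemidef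
  exact hN.submatrix _

/-- Trace is invariant under reindexing by one equivalence. [cite: FawziParrilo2013, §1.1 (p. 3)] -/
private theorem trace_submatrix_equiv'' {p q : Type*} [Fintype p] [Fintype q] (X : Matrix q q ℝ)
    (e : p ≃ q) : (X.submatrix e e).trace = X.trace := by
  simp only [Matrix.trace, Matrix.diag, submatrix_apply]
  exact Fintype.sum_equiv e _ _ fun _ => rfl

/-- `⟨U, diag(M_t)⟩ = Σ_t ⟨U_tt, M_t⟩`. [cite: FawziParrilo2013, §1.2 (p. 5, "sum of r matrices each of psd rank ≤ d")] -/
theorem trace_mul_embed (U : Matrix (Fin (d * r)) (Fin (d * r)) ℝ) (M : Fin r → Matrix (Fin d) (Fin d) ℝ) :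
    (U * embed d r M).trace = ∑ t, (extract d r U t * M t).trace := by
  classical
  set e : Fin d × Fin r ≃ Fin (d * r) := finProdFinEquiv with he
  have hU' : (U.submatrix e e).submatrix e.symm e.symm = U := by
    ext p q; simp
  calc (U * embed d r M).trace
      = ((U.submatrix e e).submatrix e.symm e.symm * (blockDiagonal M).submatrix e.symm e.symm).trace := by
        rw [hU']; rfl
    _ = (((U.submatrix e e) * blockDiagonal M).submatrix e.symm e.symm).trace := by
        rw [submatrix_mul_equiv]
    _ = ((U.submatrix e e) * blockDiagonal M).trace := trace_submatrix_equiv'' _ _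
    _ = ∑ t, (extract d r U t * M t).trace := by
        simp only [Matrix.trace, Matrix.diag, Matrix.mul_apply, submatrix_apply, Fintype.sum_prod_type,
          blockDiagonal_apply, mul_ite, mul_zero, Finset.sum_ite_eq', Finset.mem_univ, if_true]
        rw [Finset.sum_comm]
        rfl

/-! ### Conic duality on a block psd lift (reduction to the tree's Slater-free certificate on `S^{dr}_+`) -/

/-- **Duality certificates on `(S^d_+)^r ∩ L`, no Slater point needed.** If a linear functional `g` is
bounded above by `β` on the nonempty set `(S^d_+)^r ∩ L`, then there are psd `U_1,…,U_r` and `μ ≥ 0` with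
`β − g(M) = Σ_t tr(U_t M_t) + μ` on `(S^d_+)^r ∩ L` (reduction to `exists_posSemidef_certificate_of_le_on_psdLift`
through the block-diagonal embedding; the "for some F ∈ K*" step of FP13 Thm. 2 in Slater-free form).
[cite: FawziParrilo2013, Thm. 2 (§2.1, p. 6)] [cite: FawziEtAl2015, Thm. 3.3 proof (p10)] -/
theorem exists_block_certificate (L : AffineSubspace ℝ (Fin r → Matrix (Fin d) (Fin d) ℝ))
    (g : (Fin r → Matrix (Fin d) (Fin d) ℝ) →ₗ[ℝ] ℝ) (β : ℝ)
    (hne : ∃ M : Fin r → Matrix (Fin d) (Fin d) ℝ, (∀ t, (M t).PosSemidef) ∧ M ∈ L)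
    (hg : ∀ M : Fin r → Matrix (Fin d) (Fin d) ℝ, (∀ t, (M t).PosSemidef) → M ∈ L → g M ≤ β) :
    ∃ U : Fin r → Matrix (Fin d) (Fin d) ℝ, (∀ t, (U t).PosSemidef) ∧ ∃ μ : ℝ, 0 ≤ μ ∧
      ∀ M : Fin r → Matrix (Fin d) (Fin d) ℝ, (∀ t, (M t).PosSemidef) → M ∈ L →
        β - g M = ∑ t, (U t * M t).trace + μ := by
  obtain ⟨M₀, hM₀, hM₀L⟩ := hne
  let L' : AffineSubspace ℝ (Matrix (Fin (d * r)) (Fin (d * r)) ℝ) := L.map (embed d r).toAffineMap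
  let g' : Matrix (Fin (d * r)) (Fin (d * r)) ℝ →ₗ[ℝ] ℝ := g ∘ₗ extract d r
  have hne' : ∃ N : Matrix (Fin (d * r)) (Fin (d * r)) ℝ, N.PosSemidef ∧ N ∈ L' :=
    ⟨embed d r M₀, (posSemidef_embed_iff M₀).2 hM₀, AffineSubspace.mem_map.2 ⟨M₀, hM₀L, rfl⟩⟩
  have hg' : ∀ N : Matrix (Fin (d * r)) (Fin (d * r)) ℝ, N.PosSemidef → N ∈ L' → g' N ≤ β := by
    intro N hN hNL
    obtain ⟨M, hML, rfl⟩ := AffineSubspace.mem_map.1 hNL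
    change g (extract d r (embed d r M)) ≤ β
    rw [extract_embed]
    exact hg M ((posSemidef_embed_iff M).1 hN) hML
  obtain ⟨U', hU', μ, hμ, hc⟩ := exists_posSemidef_certificate_of_le_on_psdLift L' g' β hne' hg'
  refine ⟨extract d r U', posSemidef_extract hU', μ, hμ, fun M hM hML => ?_⟩
  have h := hc (embed d r M) ((posSemidef_embed_iff M).2 hM) (AffineSubspace.mem_map.2 ⟨M, hML, rfl⟩)
  change β - g (extract d r (embed d r M)) = _ at h
  rw [extract_embed, trace_mul_embed] at h
  exact h

end BlockPsdLift

/-! ### `(S^d_+)^r`-lifts are `S^{dr}_+`-lifts -/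

/-- **"Any `(S^d_+)^r`-lift of `P` is an `S^{rd}_+`-lift"** (block-diagonal embedding at the level of lifts:
`L' = diag(L)`, `π' = π ∘ extract`), so "lower bounds on the size of `(S^d_+)^r` lifts can be obtained from lower
bounds on PSD-lifts" — e.g. every psd-rank lower bound of the tree bounds `d·r`.
[cite: FawziParrilo2013, §1.1 (p. 3)] -/
theorem HasBlockPsdLift.hasPsdLift {E : Type*} [AddCommGroup E] [Module ℝ E] {C : Set E} {d r : ℕ}
    (h : HasBlockPsdLift C d r) : HasPsdLift C (d * r) := by
  obtain ⟨L, π, rfl⟩ := h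
  refine ⟨L.map (BlockPsdLift.embed d r).toAffineMap, π ∘ₗ BlockPsdLift.extract d r, ?_⟩
  ext y
  constructor
  · rintro ⟨M, ⟨hM, hML⟩, rfl⟩
    refine ⟨BlockPsdLift.embed d r M, ⟨(BlockPsdLift.posSemidef_embed_iff M).2 hM,
      AffineSubspace.mem_map.2 ⟨M, hML, rfl⟩⟩, ?_⟩
    change π (BlockPsdLift.extract d r (BlockPsdLift.embed d r M)) = π M
    rw [BlockPsdLift.extract_embed]
  · rintro ⟨N, ⟨hN, hNL⟩, rfl⟩
    obtain ⟨M, hML, rfl⟩ := AffineSubspace.mem_map.1 hNL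
    refine ⟨M, ⟨(BlockPsdLift.posSemidef_embed_iff M).1 hN, hML⟩, ?_⟩
    change π M = π (BlockPsdLift.extract d r (BlockPsdLift.embed d r M))
    rw [BlockPsdLift.extract_embed]

/-! ### `S²_+ ≅ L²`: blocks of size `2` are second-order cones -/

/-- **`S²_+` is the second-order cone `L²`** (FP13 p. 4, verbatim: "`t ≥ √(x² + y²) ⇔ [[t+x, y],[y, t−x]] ⪰ 0`"),
so `(S²_+)^r`-lifts are second-order-cone programs with `r` cones `L²` ("for second-order cone programming it is
sufficient to work with Cartesian products of `L²`"). [cite: FawziParrilo2013, §1.2 (p. 4)] -/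
theorem posSemidef_lorentz_two_iff (t x y : ℝ) :
    (!![t + x, y; y, t - x] : Matrix (Fin 2) (Fin 2) ℝ).PosSemidef ↔ Real.sqrt (x ^ 2 + y ^ 2) ≤ t := by
  have hquad : ∀ v : Fin 2 → ℝ, star v ⬝ᵥ ((!![t + x, y; y, t - x] : Matrix (Fin 2) (Fin 2) ℝ) *ᵥ v) =
      (t + x) * v 0 * v 0 + 2 * y * v 0 * v 1 + (t - x) * v 1 * v 1 := by
    intro v
    simp [Matrix.mulVec, dotProduct, Fin.sum_univ_two]
    ring
  constructor
  · intro h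
    have hq : ∀ a b : ℝ, 0 ≤ (t + x) * a * a + 2 * y * a * b + (t - x) * b * b := by
      intro a b
      have := h.dotProduct_mulVec_nonneg ![a, b]
      rw [hquad] at this
      simpa using this
    have h1 : 0 ≤ t + x := by nlinarith [hq 1 0]
    have h2 : 0 ≤ t - x := by nlinarith [hq 0 1]
    have ht : 0 ≤ t := by linarith
    have h3 : y ^ 2 ≤ (t + x) * (t - x) := by
      rcases h1.lt_or_eq with hpos | hzero
      · have e1 := hq (-y) (t + x)
        have key : (t + x) * -y * -y + 2 * y * -y * (t + x) + (t - x) * (t + x) * (t + x)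
            = (t + x) * ((t + x) * (t - x) - y ^ 2) := by ring
        rw [key] at e1
        by_contra hc
        push Not at hc
        have : (t + x) * ((t + x) * (t - x) - y ^ 2) < 0 := mul_neg_of_pos_of_neg hpos (by linarith)
        linarith
      · have hy : y = 0 := by
          by_contra hy0
          have e := hq (-(t - x + 1) / (2 * y)) 1
          rw [← hzero] at e
          have hu : 2 * y * (-(t - x + 1) / (2 * y)) = -(t - x + 1) := by field_simp
          nlinarith [hu, e]
        subst hy
        rw [← hzero]
        simp
    rw [Real.sqrt_le_left ht]
    nlinarith [h3]
  · intro h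
    have ht : 0 ≤ t := (Real.sqrt_nonneg _).trans h
    have h2 : x ^ 2 + y ^ 2 ≤ t ^ 2 := (Real.sqrt_le_left ht).1 h
    have h1 : 0 ≤ t + x := by nlinarith [sq_nonneg y, sq_nonneg (t + x), sq_nonneg (t - x)]
    refine Matrix.PosSemidef.of_dotProduct_mulVec_nonneg ?_ fun v => ?_
    · refine Matrix.IsHermitian.ext fun i j => ?_
      fin_cases i <;> fin_cases j <;> simp
    · rw [hquad]
      rcases h1.lt_or_eq with hpos | hzero
      · by_contra hQ
        push Not at hQ
        have key : (t + x) * ((t + x) * v 0 * v 0 + 2 * y * v 0 * v 1 + (t - x) * v 1 * v 1)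
            = ((t + x) * v 0 + y * v 1) ^ 2 + (t ^ 2 - x ^ 2 - y ^ 2) * v 1 ^ 2 := by ring
        have hnn : 0 ≤ ((t + x) * v 0 + y * v 1) ^ 2 + (t ^ 2 - x ^ 2 - y ^ 2) * v 1 ^ 2 := by
          nlinarith [sq_nonneg ((t + x) * v 0 + y * v 1), sq_nonneg (v 1), h2]
        have := mul_neg_of_pos_of_neg hpos hQ
        linarith [key]
      · have hy : y = 0 := by
          have : y ^ 2 ≤ 0 := by nlinarith [h2, hzero]
          exact pow_eq_zero_iff (n := 2) (by norm_num) |>.1 (le_antisymm this (sq_nonneg y))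
        rw [hy]
        have htx : t - x = 2 * t := by linarith
        rw [htx]
        nlinarith [sq_nonneg (v 1), ht, hzero, sq_nonneg (v 0)]

/-! ### `(S^d_+)^r`-factorizations: transpose -/

/-- Transposing an `(S^d_+)^r`-factorization. [cite: FawziParrilo2013, §1.2 (p. 5)] -/
theorem FixedSizePsdRank.HasPsdPowerFactorization.transpose {ι κ : Type*} {M : ι → κ → ℝ} {d r : ℕ}
    (h : FixedSizePsdRank.HasPsdPowerFactorization M d r) :
    FixedSizePsdRank.HasPsdPowerFactorization (fun j i => M i j) d r := by
  obtain ⟨A, B, hA, hB, hM⟩ := h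
  refine ⟨B, A, hB, hA, fun j i => ?_⟩
  change M i j = _
  rw [hM]
  exact sum_congr rfl fun t _ => Matrix.trace_mul_comm _ _

/-! ### Lift ⇒ factorization -/

open FixedSizePsdRank in
open Literature.Computation.Certificates.SemidefiniteComplementarity in
/-- **Fawzi–Parrilo Thm. 2 (= Gouveia–Parrilo–Thomas), direction "lift ⇒ factorization", for
`K = (S^d_+)^r`.** FP13 Thm. 2 (p. 6, verbatim): "`P = π(K ∩ L)`. Then for any linear form `ℓ` such that
`ℓ ≤ ℓ_max` on `P` there exist `F ∈ K*` such that `ℓ_max − ℓ(x_i) = ⟨F, y_i⟩`, `y_i ∈ K ∩ L`, `π(y_i) = x_i`";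
as used (§1.2 p. 5): an `(S^d_+)^r`-lift gives "a decomposition of the slack matrix as a sum of `r` … matrices
of psd rank `≤ d`". Typed Slater-free and for arbitrary families: if `C = π((S^d_+)^r ∩ L) ⊆ ℝ^V` (`V` finite, `d, r ≥ 1`)
is BOUNDED, contains the points `x_i` (`i ∈ ι`, any index type) and satisfies the linear inequalities
`a_jᵀ y ≤ b_j` (`j ∈ J`, any index type), then `(b_j − a_jᵀ x_i)` has an `(S^d_+)^r`-factorization. Proof as
the tree's `HasPsdLift.hasPsdFactorization_pairSlackMatrix`: blockwise certificates `b_j − a_jᵀπ(M) =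
Σ_t ⟨U_{j,t}, M_t⟩ + μ_j` (`exists_block_certificate`), and the constants `μ_j ≥ 0` are absorbed using
`E ⪰ 0` with `Σ_t ⟨E_t, M_t⟩ = 1` on `(S^d_+)^r ∩ L`, built here from the certificates of `±(πM₁ − πM₂)ᵀy`
for two distinct points of `C` (boundedness of `C` replaces LP duality; when `C` is a point, `A_{i,t} = I_d`,
`B_{j,t} = s_j/(dr)·I_d`). [cite: FawziParrilo2013, Thm. 2 (§2.1, p. 6) and §1.2 (p. 5)]
[cite: GouveiaParriloThomas2013, Thm. 2.4 (§2)] -/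
theorem HasBlockPsdLift.hasPsdPowerFactorization_slack {d r : ℕ} {V ι J : Type*} [Fintype V]
    {x : ι → (V → ℝ)} {a : J → (V → ℝ)} {b : J → ℝ} (hd : 1 ≤ d) (hr : 1 ≤ r)
    {C : Set (V → ℝ)} (hC : HasBlockPsdLift C d r) (hCb : Bornology.IsBounded C)
    (hxC : ∀ i, x i ∈ C) (hCQ : ∀ y ∈ C, ∀ j, a j ⬝ᵥ y ≤ b j) :
    HasPsdPowerFactorization (fun i j => b j - a j ⬝ᵥ x i) d r := by
  classical
  obtain ⟨L, π, rfl⟩ := hC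
  have hd0 : (d : ℝ) ≠ 0 := by exact_mod_cast Nat.one_le_iff_ne_zero.mp hd
  have hr0 : (r : ℝ) ≠ 0 := by exact_mod_cast Nat.one_le_iff_ne_zero.mp hr
  by_cases hsub : (π '' {M : Fin r → Matrix (Fin d) (Fin d) ℝ | (∀ t, (M t).PosSemidef) ∧ M ∈ L}).Subsingleton
  · -- `C` is a point (or empty): `S_{ij} = s_j ≥ 0`, factor through identity blocks
    rcases isEmpty_or_nonempty ι with hι | ⟨⟨i₀⟩⟩
    · exact ⟨fun i => isEmptyElim i, fun _ _ => 0, fun i => isEmptyElim i, fun _ _ => PosSemidef.zero,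
        fun i => isEmptyElim i⟩
    · have hxi : ∀ i, x i = x i₀ := fun i => hsub (hxC i) (hxC i₀)
      have hs : ∀ j, 0 ≤ b j - a j ⬝ᵥ x i₀ := fun j => sub_nonneg.mpr (hCQ _ (hxC i₀) j)
      refine ⟨fun _ _ => 1, fun j _ => ((b j - a j ⬝ᵥ x i₀) / (d * r)) • (1 : Matrix (Fin d) (Fin d) ℝ),
        fun _ _ => PosSemidef.one, fun j _ => PosSemidef.one.smul (div_nonneg (hs j) (by positivity)),
        fun i j => ?_⟩
      change b j - a j ⬝ᵥ x i = ∑ _t : Fin r, ((1 : Matrix (Fin d) (Fin d) ℝ) *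
        (((b j - a j ⬝ᵥ x i₀) / (d * r)) • (1 : Matrix (Fin d) (Fin d) ℝ))).trace
      rw [hxi i]
      simp only [Matrix.one_mul, trace_smul, trace_one, smul_eq_mul, Fintype.card_fin, Finset.sum_const,
        Finset.card_univ, nsmul_eq_mul]
      field_simp
  · -- two distinct points `π M₁ ≠ π M₂` of `C`
    obtain ⟨_, ⟨M₁, hM₁, rfl⟩, _, ⟨M₂, hM₂, rfl⟩, hne⟩ := Set.not_subsingleton_iff.mp hsub
    -- every linear functional is bounded above on `C`
    obtain ⟨R, hR⟩ := isBounded_iff_forall_norm_le.mp hCb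
    have hbdd : ∀ c : V → ℝ, ∀ y ∈ π '' {M : Fin r → Matrix (Fin d) (Fin d) ℝ |
        (∀ t, (M t).PosSemidef) ∧ M ∈ L}, c ⬝ᵥ y ≤ (∑ i, |c i|) * R := by
      intro c y hy
      have hyR := hR y hy
      calc c ⬝ᵥ y = ∑ i, c i * y i := rfl
        _ ≤ ∑ i, |c i| * R := sum_le_sum fun i _ => by
            have h1 : c i * y i ≤ |c i| * |y i| := by rw [← abs_mul]; exact le_abs_self _
            have h2 : |y i| ≤ R := by
              have := norm_le_pi_norm y i
              rw [Real.norm_eq_abs] at this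
              exact this.trans hyR
            nlinarith [abs_nonneg (c i)]
        _ = (∑ i, |c i|) * R := by rw [Finset.sum_mul]
    -- block certificates for a functional bounded by `β` on `C`
    have hcertOf : ∀ (c : V → ℝ) (β : ℝ),
        (∀ y ∈ π '' {M : Fin r → Matrix (Fin d) (Fin d) ℝ | (∀ t, (M t).PosSemidef) ∧ M ∈ L}, c ⬝ᵥ y ≤ β) →
        ∃ U : Fin r → Matrix (Fin d) (Fin d) ℝ, (∀ t, (U t).PosSemidef) ∧ ∃ μ : ℝ, 0 ≤ μ ∧
          ∀ M : Fin r → Matrix (Fin d) (Fin d) ℝ, (∀ t, (M t).PosSemidef) → M ∈ L →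
            β - c ⬝ᵥ π M = ∑ t, (U t * M t).trace + μ := by
      intro c β hcβ
      let g : (Fin r → Matrix (Fin d) (Fin d) ℝ) →ₗ[ℝ] ℝ :=
        { toFun := fun M => c ⬝ᵥ π M
          map_add' := fun M M' => by simp only [map_add, dotProduct_add]
          map_smul' := fun s M => by simp only [map_smul, dotProduct_smul, RingHom.id_apply] }
      exact BlockPsdLift.exists_block_certificate L g β ⟨M₁, hM₁⟩
        fun M hM hML => hcβ _ ⟨M, ⟨hM, hML⟩, rfl⟩
    have hcert : ∀ j, ∃ U : Fin r → Matrix (Fin d) (Fin d) ℝ, (∀ t, (U t).PosSemidef) ∧ ∃ μ : ℝ, 0 ≤ μ ∧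
        ∀ M : Fin r → Matrix (Fin d) (Fin d) ℝ, (∀ t, (M t).PosSemidef) → M ∈ L →
          b j - a j ⬝ᵥ π M = ∑ t, (U t * M t).trace + μ :=
      fun j => hcertOf (a j) (b j) fun y hy => hCQ y hy j
    choose U hU μ hμ hUμ using hcert
    -- preimages `A_i ∈ (S^d_+)^r ∩ L` of the points `x_i`
    have hpre : ∀ i, ∃ M : Fin r → Matrix (Fin d) (Fin d) ℝ, ((∀ t, (M t).PosSemidef) ∧ M ∈ L) ∧ π M = x i :=
      fun i => hxC i
    choose A hA hAx using hpre
    -- certificates for `±c`, `c = π M₁ − π M₂ ≠ 0`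
    set c : V → ℝ := π M₁ - π M₂ with hc
    have hc0 : c ≠ 0 := sub_ne_zero.mpr hne
    obtain ⟨U₁, hU₁, μ₁, hμ₁, h₁⟩ := hcertOf c _ (hbdd c)
    obtain ⟨U₂, hU₂, μ₂, hμ₂, h₂⟩ := hcertOf (-c) _ (hbdd (-c))
    set β₁ : ℝ := (∑ i, |c i|) * R with hβ₁
    set β₂ : ℝ := (∑ i, |(-c) i|) * R with hβ₂
    set w : ℝ := β₁ + β₂ - μ₁ - μ₂ with hw
    -- `Σ_t ⟨(U₁+U₂)_t, M_t⟩ = w` on the feasible set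
    have hUbar : ∀ M : Fin r → Matrix (Fin d) (Fin d) ℝ, (∀ t, (M t).PosSemidef) → M ∈ L →
        ∑ t, ((U₁ t + U₂ t) * M t).trace = w := by
      intro M hM hML
      have e1 := h₁ M hM hML
      have e2 := h₂ M hM hML
      simp only [neg_dotProduct] at e2
      simp only [Matrix.add_mul, trace_add, Finset.sum_add_distrib]
      linarith
    -- `w > 0`: otherwise `cᵀ y` would be constant on `C`
    have hwpos : 0 < w := by
      by_contra hle
      push Not at hle
      have hterm : ∀ M : Fin r → Matrix (Fin d) (Fin d) ℝ, (∀ t, (M t).PosSemidef) → M ∈ L →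
          ∑ t, (U₁ t * M t).trace = 0 := by
        intro M hM hML
        have hnn1 : 0 ≤ ∑ t, (U₁ t * M t).trace :=
          sum_nonneg fun t _ => frob_nonneg_of_posSemidef (hU₁ t) (hM t)
        have hnn2 : 0 ≤ ∑ t, (U₂ t * M t).trace :=
          sum_nonneg fun t _ => frob_nonneg_of_posSemidef (hU₂ t) (hM t)
        have hsum := hUbar M hM hML
        simp only [Matrix.add_mul, trace_add, Finset.sum_add_distrib] at hsum
        linarith
      have hcπ : ∀ M : Fin r → Matrix (Fin d) (Fin d) ℝ, (∀ t, (M t).PosSemidef) → M ∈ L →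
          c ⬝ᵥ π M = β₁ - μ₁ := by
        intro M hM hML
        have e1 := h₁ M hM hML
        rw [hterm M hM hML] at e1
        linarith
      have h12 : c ⬝ᵥ (π M₁ - π M₂) = 0 := by
        rw [dotProduct_sub, hcπ M₁ hM₁.1 hM₁.2, hcπ M₂ hM₂.1 hM₂.2, sub_self]
      exact hc0 (dotProduct_self_eq_zero.mp h12)
    -- `E ⪰ 0` blockwise with `Σ_t ⟨E_t, M_t⟩ = 1` on `(S^d_+)^r ∩ L`
    set E : Fin r → Matrix (Fin d) (Fin d) ℝ := fun t => w⁻¹ • (U₁ t + U₂ t) with hE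
    have hEpsd : ∀ t, (E t).PosSemidef := fun t =>
      ((hU₁ t).add (hU₂ t)).smul (inv_nonneg.mpr hwpos.le)
    have hE1 : ∀ M : Fin r → Matrix (Fin d) (Fin d) ℝ, (∀ t, (M t).PosSemidef) → M ∈ L →
        ∑ t, (E t * M t).trace = 1 := by
      intro M hM hML
      simp only [hE, Matrix.smul_mul, trace_smul, smul_eq_mul, ← Finset.mul_sum, hUbar M hM hML]
      exact inv_mul_cancel₀ hwpos.ne'
    refine ⟨A, fun j t => U j t + μ j • E t, fun i t => (hA i).1 t,
      fun j t => (hU j t).add ((hEpsd t).smul (hμ j)), fun i j => ?_⟩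
    change b j - a j ⬝ᵥ x i = ∑ t, (A i t * (U j t + μ j • E t)).trace
    rw [← hAx i, hUμ j (A i) (hA i).1 (hA i).2]
    simp only [Matrix.mul_add, trace_add, Matrix.mul_smul, trace_smul, smul_eq_mul, Finset.sum_add_distrib,
      ← Finset.mul_sum]
    rw [show ∑ t, (A i t * U j t).trace = ∑ t, (U j t * A i t).trace from
        sum_congr rfl fun t _ => trace_mul_comm _ _,
      show ∑ t, (A i t * E t).trace = ∑ t, (E t * A i t).trace from
        sum_congr rfl fun t _ => trace_mul_comm _ _, hE1 (A i) (hA i).1 (hA i).2, mul_one]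

/-! ### Factorization ⇒ lift (the converse direction of Gouveia–Parrilo–Thomas Thm. 2.4 for `(S^d_+)^r`) -/

/-- The empty set has an `(S^d_+)^r`-lift (`L = ⊥`). [cite: GouveiaParriloThomas2013, Def. 2.2 (§2)] -/
theorem hasBlockPsdLift_empty {E : Type*} [AddCommGroup E] [Module ℝ E] (d r : ℕ) :
    HasBlockPsdLift (∅ : Set E) d r := by
  refine ⟨⊥, 0, ?_⟩
  have : {M : Fin r → Matrix (Fin d) (Fin d) ℝ | (∀ t, (M t).PosSemidef) ∧
      M ∈ (⊥ : AffineSubspace ℝ (Fin r → Matrix (Fin d) (Fin d) ℝ))} = ∅ :=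
    Set.eq_empty_of_forall_notMem fun M hM =>
      AffineSubspace.notMem_bot (k := ℝ) (V := Fin r → Matrix (Fin d) (Fin d) ℝ) M hM.2
  rw [this, Set.image_empty]

/-- A point has an `(S^d_+)^r`-lift for `d, r ≥ 1`: `L = {(I_d,…,I_d)}`, `π(M) = (Σ_t tr M_t)/(dr) · x₀`.
[cite: GouveiaParriloThomas2013, Def. 2.2 (§2)] -/
theorem hasBlockPsdLift_singleton {E : Type*} [AddCommGroup E] [Module ℝ E] (x₀ : E) {d r : ℕ}
    (hd : 1 ≤ d) (hr : 1 ≤ r) : HasBlockPsdLift ({x₀} : Set E) d r := by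
  classical
  let One : Fin r → Matrix (Fin d) (Fin d) ℝ := fun _ => 1
  let L : AffineSubspace ℝ (Fin r → Matrix (Fin d) (Fin d) ℝ) := AffineSubspace.mk' One ⊥
  let τ : (Fin r → Matrix (Fin d) (Fin d) ℝ) →ₗ[ℝ] ℝ :=
    ∑ t : Fin r, (Matrix.traceLinearMap (Fin d) ℝ ℝ).comp (LinearMap.proj t)
  have hτ : ∀ M : Fin r → Matrix (Fin d) (Fin d) ℝ, τ M = ∑ t, (M t).trace := fun M => by
    simp [τ, Matrix.traceLinearMap_apply]
  let π : (Fin r → Matrix (Fin d) (Fin d) ℝ) →ₗ[ℝ] E :=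
    (LinearMap.toSpanSingleton ℝ E x₀).comp ((((d : ℝ) * r)⁻¹) • τ)
  refine ⟨L, π, ?_⟩
  have hL : ∀ M : Fin r → Matrix (Fin d) (Fin d) ℝ, M ∈ L ↔ M = One := by
    intro M
    simp [L, AffineSubspace.mem_mk', Submodule.mem_bot, sub_eq_zero]
  have hset : {M : Fin r → Matrix (Fin d) (Fin d) ℝ | (∀ t, (M t).PosSemidef) ∧ M ∈ L} = {One} := by
    ext M
    simp only [Set.mem_setOf_eq, Set.mem_singleton_iff, hL]
    exact ⟨fun h => h.2, fun h => ⟨fun t => h ▸ Matrix.PosSemidef.one, h⟩⟩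
  rw [hset, Set.image_singleton]
  have hd0 : (d : ℝ) ≠ 0 := by exact_mod_cast Nat.one_le_iff_ne_zero.mp hd
  have hr0 : (r : ℝ) ≠ 0 := by exact_mod_cast Nat.one_le_iff_ne_zero.mp hr
  have hπ : π One = x₀ := by
    simp only [π, LinearMap.comp_apply, LinearMap.smul_apply, hτ, One, Matrix.trace_one, Fintype.card_fin,
      Finset.sum_const, Finset.card_univ, nsmul_eq_mul, LinearMap.toSpanSingleton_apply, smul_eq_mul]
    rw [show ((d : ℝ) * r)⁻¹ * (r * d) = 1 by field_simp, one_smul]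
  rw [hπ]

/-- A bounded set containing a ray `{y + t z : t ≥ 0}` has `z = 0`. [cite: GouveiaParriloThomas2013, Thm. 2.4 proof (§2)] -/
private theorem eq_zero_of_ray_subset' {V : Type*} [Fintype V] {Q : Set (V → ℝ)} (hQ : Bornology.IsBounded Q)
    {y z : V → ℝ} (h : ∀ t : ℝ, 0 ≤ t → y + t • z ∈ Q) : z = 0 := by
  obtain ⟨R, hR⟩ := isBounded_iff_forall_norm_le.mp hQ
  by_contra hz
  have hzn : 0 < ‖z‖ := norm_pos_iff.mpr hz
  have hy : ‖y‖ ≤ R := by simpa using hR _ (h 0 le_rfl)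
  set t : ℝ := (R + ‖y‖ + 1) / ‖z‖ with ht_def
  have ht : 0 ≤ t := div_nonneg (by linarith [norm_nonneg y]) hzn.le
  have hmem := hR _ (h t ht)
  have htz : t * ‖z‖ = R + ‖y‖ + 1 := div_mul_cancel₀ _ hzn.ne'
  have h1 : ‖t • z‖ ≤ ‖y + t • z‖ + ‖y‖ := by
    have := norm_sub_le (y + t • z) y
    rwa [add_sub_cancel_left] at this
  rw [norm_smul, Real.norm_of_nonneg ht] at h1
  linarith

/-- `(S^d_+)^r ∩ L` is convex. [cite: GouveiaParriloThomas2013, Def. 2.2 (§2)] -/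
private theorem convex_blockPsd_inter {d r : ℕ} (L : AffineSubspace ℝ (Fin r → Matrix (Fin d) (Fin d) ℝ)) :
    Convex ℝ {M : Fin r → Matrix (Fin d) (Fin d) ℝ | (∀ t, (M t).PosSemidef) ∧ M ∈ L} := by
  have h1 : Convex ℝ {M : Fin r → Matrix (Fin d) (Fin d) ℝ | ∀ t, (M t).PosSemidef} := by
    intro M hM N hN u v hu hv _ t
    simp only [Pi.add_apply, Pi.smul_apply]
    exact ((hM t).smul hu).add ((hN t).smul hv)
  have h2 : Convex ℝ (L : Set (Fin r → Matrix (Fin d) (Fin d) ℝ)) := L.convex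
  simpa [Set.setOf_and] using h1.inter h2

open scoped Pointwise in
/-- **Translations** (bounded sets, `d, r ≥ 1`): `v +ᵥ C` has an `(S^d_+)^r`-lift when the bounded set `C` has one —
lifts use LINEAR maps `π`, and the constant is produced by a linear functional `θ` with `θ ≡ 1` on `L` (which exists
unless `0 ∈ L`, in which case the bounded cone `C` is `{0}`). So for polytopes the choice of origin is immaterial.
[cite: GouveiaParriloThomas2013, Def. 2.2 (§2)] -/
theorem HasBlockPsdLift.vadd {V : Type*} [Fintype V] {C : Set (V → ℝ)} {d r : ℕ} (h : HasBlockPsdLift C d r)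
    (hC : Bornology.IsBounded C) (hd : 1 ≤ d) (hr : 1 ≤ r) (v : V → ℝ) : HasBlockPsdLift (v +ᵥ C) d r := by
  classical
  rcases C.eq_empty_or_nonempty with rfl | hne
  · rw [Set.vadd_set_empty]; exact hasBlockPsdLift_empty d r
  obtain ⟨L, π, rfl⟩ := h
  obtain ⟨_, ⟨M₀, ⟨hM₀K, hM₀L⟩, rfl⟩⟩ := hne
  by_cases h0 : M₀ ∈ L.direction
  · -- `0 ∈ L`: the feasible set is a cone, `C` is a bounded cone, `C = {0}`
    have hL0 : (0 : Fin r → Matrix (Fin d) (Fin d) ℝ) ∈ L := by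
      have := AffineSubspace.vadd_mem_of_mem_direction (L.direction.neg_mem h0) hM₀L
      rwa [vadd_eq_add, neg_add_cancel] at this
    have hzero : ∀ M : Fin r → Matrix (Fin d) (Fin d) ℝ, (∀ t, (M t).PosSemidef) → M ∈ L → π M = 0 := by
      intro M hM hML
      refine eq_zero_of_ray_subset' hC (y := 0) fun t ht => ⟨t • M, ⟨fun s => ?_, ?_⟩, by simp⟩
      · simpa using (hM s).smul ht
      · have hdir : t • M ∈ L.direction := by
          have := AffineSubspace.vsub_mem_direction hML hL0
          rw [vsub_eq_sub, sub_zero] at this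
          exact L.direction.smul_mem t this
        have := AffineSubspace.vadd_mem_of_mem_direction hdir hL0
        rwa [vadd_eq_add, add_zero] at this
    have hC0 : π '' {M | (∀ t, (M t).PosSemidef) ∧ M ∈ L} = {0} := by
      refine Set.eq_singleton_iff_unique_mem.2 ⟨⟨M₀, ⟨hM₀K, hM₀L⟩, hzero M₀ hM₀K hM₀L⟩, ?_⟩
      rintro _ ⟨M, ⟨hM, hML⟩, rfl⟩
      exact hzero M hM hML
    rw [hC0, Set.vadd_set_singleton, vadd_eq_add, add_zero]
    exact hasBlockPsdLift_singleton v hd hr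
  · -- a linear functional `θ` with `θ|_{L.direction} = 0`, `θ M₀ = 1`, hence `θ ≡ 1` on `L`
    obtain ⟨θ, hθW, hθ0⟩ := LinearMap.exists_extend_of_notMem (0 : L.direction →ₗ[ℝ] ℝ) h0 (1 : ℝ)
    have hθL : ∀ M ∈ L, θ M = 1 := by
      intro M hML
      have hW : M - M₀ ∈ L.direction := by
        have := AffineSubspace.vsub_mem_direction hML hM₀L
        rwa [vsub_eq_sub] at this
      have h1 : θ (M - M₀) = 0 := by
        have := congrArg (fun f => f ⟨M - M₀, hW⟩) hθW
        simpa using this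
      rw [map_sub, hθ0, sub_eq_zero] at h1
      exact h1
    refine ⟨L, π + (LinearMap.toSpanSingleton ℝ (V → ℝ) v) ∘ₗ θ, ?_⟩
    ext y
    constructor
    · rintro ⟨c, ⟨M, ⟨hM, hML⟩, rfl⟩, rfl⟩
      refine ⟨M, ⟨hM, hML⟩, ?_⟩
      simp only [LinearMap.add_apply, LinearMap.coe_comp, Function.comp_apply,
        LinearMap.toSpanSingleton_apply, hθL M hML, one_smul, vadd_eq_add]
      rw [add_comm]
    · rintro ⟨M, ⟨hM, hML⟩, rfl⟩
      refine ⟨π M, ⟨M, ⟨hM, hML⟩, rfl⟩, ?_⟩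
      simp only [LinearMap.add_apply, LinearMap.coe_comp, Function.comp_apply,
        LinearMap.toSpanSingleton_apply, hθL M hML, one_smul, vadd_eq_add]
      rw [add_comm]

open FixedSizePsdRank in
open Literature.Computation.Certificates.SemidefiniteComplementarity in
/-- **Gouveia–Parrilo–Thomas Thm. 2.4 for `K = (S^d_+)^r`, direction "factorization ⇒ lift"** (the block
version of the tree's `HasPsdFactorization.exists_hasPsdLift_between`, FGPRT Thm. 3.3 / GRT Prop. 3.6): from an
`(S^d_+)^r`-factorization `b_j − a_jᵀx_i = Σ_t ⟨A_{i,t}, B_{j,t}⟩` (`d, r ≥ 1`) with `Q = {y : a_jᵀy ≤ b_j}` BOUNDED,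
the set `C = {y : ∃ M ∈ (S^d_+)^r, b_j − a_jᵀy = Σ_t ⟨M_t, B_{j,t}⟩ ∀ j}` satisfies `conv(x_i) ⊆ C ⊆ Q` and is an
`(S^d_+)^r`-lift `π((S^d_+)^r ∩ L)` with `π` linear (`L = Φ⁻¹(b + range T)`, `π = −G ∘ Φ`, `G` a linear left
inverse of `T : y ↦ (a_jᵀy)_j` with `G b = 0`; the degenerate cases `Q` a point / no points as in the tree).
[cite: GouveiaParriloThomas2013, Thm. 2.4 (§2)] [cite: FawziEtAl2015, Thm. 3.3 (p09–p10)] -/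
theorem FixedSizePsdRank.HasPsdPowerFactorization.exists_hasBlockPsdLift_between {V ι J : Type*} [Fintype V]
    {x : ι → (V → ℝ)} {a : J → (V → ℝ)} {b : J → ℝ} {d r : ℕ} (hd : 1 ≤ d) (hr : 1 ≤ r)
    (h : HasPsdPowerFactorization (fun i j => b j - a j ⬝ᵥ x i) d r)
    (hQ : Bornology.IsBounded {y : V → ℝ | ∀ j, a j ⬝ᵥ y ≤ b j}) :
    ∃ C : Set (V → ℝ), convexHull ℝ (Set.range x) ⊆ C ∧ C ⊆ {y | ∀ j, a j ⬝ᵥ y ≤ b j} ∧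
      HasBlockPsdLift C d r := by
  classical
  obtain ⟨A, B, hA, hB, hS⟩ := h
  have hS' : ∀ i j, b j - a j ⬝ᵥ x i = ∑ t, (A i t * B j t).trace := fun i j => hS i j
  have hxQ : ∀ i j, a j ⬝ᵥ x i ≤ b j := fun i j => by
    have h1 := hS' i j
    have h2 : 0 ≤ ∑ t, (A i t * B j t).trace :=
      sum_nonneg fun t _ => frob_nonneg_of_posSemidef (hA i t) (hB j t)
    linarith
  rcases isEmpty_or_nonempty ι with hv | ⟨⟨i₀⟩⟩
  · refine ⟨∅, ?_, Set.empty_subset _, hasBlockPsdLift_empty d r⟩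
    rw [Set.range_eq_empty, convexHull_empty]
  by_cases htight : ∃ y₀ : V → ℝ, ∀ j, a j ⬝ᵥ y₀ = b j
  · -- all inequalities tight at `y₀`: `Q = {y₀}` by boundedness
    obtain ⟨y₀, hy₀⟩ := htight
    have hQpt : ∀ y : V → ℝ, (∀ j, a j ⬝ᵥ y ≤ b j) → y = y₀ := by
      intro y hy
      have hz := eq_zero_of_ray_subset' hQ (y := y₀) (z := y - y₀) fun t ht j => by
        rw [dotProduct_add, dotProduct_smul, smul_eq_mul, dotProduct_sub, hy₀ j]
        nlinarith [hy j]
      exact sub_eq_zero.mp hz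
    refine ⟨{y₀}, ?_, ?_, hasBlockPsdLift_singleton y₀ hd hr⟩
    · refine convexHull_min ?_ (convex_singleton y₀)
      rintro _ ⟨i, rfl⟩
      exact hQpt _ (hxQ i)
    · intro y hy j
      rw [Set.mem_singleton_iff] at hy
      rw [hy, hy₀ j]
  · -- generic case: `y ↦ (a_jᵀ y)_j` is injective and `b` is not in its range
    let T : (V → ℝ) →ₗ[ℝ] (J → ℝ) :=
      { toFun := fun y j => a j ⬝ᵥ y
        map_add' := fun y z => funext fun j => by simp only [dotProduct_add, Pi.add_apply]
        map_smul' := fun c y => funext fun j => by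
          simp only [dotProduct_smul, smul_eq_mul, Pi.smul_apply, RingHom.id_apply] }
    have hT : ∀ y j, T y j = a j ⬝ᵥ y := fun y j => rfl
    let T' : ((V → ℝ) × ℝ) →ₗ[ℝ] (J → ℝ) := T.coprod (LinearMap.toSpanSingleton ℝ (J → ℝ) b)
    have hT' : ∀ (y : V → ℝ) (s : ℝ) j, T' (y, s) j = a j ⬝ᵥ y + s * b j := by
      intro y s j
      simp [T', hT]
    have hT'inj : LinearMap.ker T' = ⊥ := by
      rw [LinearMap.ker_eq_bot']
      rintro ⟨y, s⟩ hys
      have hys' : ∀ j, a j ⬝ᵥ y + s * b j = 0 := fun j => by rw [← hT']; exact congrFun hys j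
      by_cases hs : s = 0
      · subst hs
        have hy0 : y = 0 := eq_zero_of_ray_subset' hQ (y := x i₀) (z := y) fun t ht j => by
          have h0 : a j ⬝ᵥ y = 0 := by simpa using hys' j
          rw [dotProduct_add, dotProduct_smul, smul_eq_mul, h0, mul_zero, add_zero]
          exact hxQ i₀ j
        rw [hy0]
        rfl
      · exfalso
        refine htight ⟨-(s⁻¹ • y), fun j => ?_⟩
        rw [dotProduct_neg, dotProduct_smul, smul_eq_mul]
        have := hys' j
        field_simp
        linarith
    obtain ⟨G', hG'⟩ := T'.exists_leftInverse_of_injective hT'inj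
    let G : (J → ℝ) →ₗ[ℝ] (V → ℝ) := (LinearMap.fst ℝ (V → ℝ) ℝ).comp G'
    have hG'T' : ∀ p : (V → ℝ) × ℝ, G' (T' p) = p := fun p => LinearMap.congr_fun hG' p
    have hGT : ∀ y, G (T y) = y := fun y => by
      have h1 := hG'T' (y, 0)
      have h2 : T' (y, 0) = T y := by
        ext j
        rw [hT', hT, zero_mul, add_zero]
      change (G' (T y)).1 = y
      rw [← h2, h1]
    have hGb : G b = 0 := by
      have h1 := hG'T' (0, 1)
      have h2 : T' ((0 : V → ℝ), (1 : ℝ)) = b := by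
        ext j
        rw [hT', dotProduct_zero, one_mul, zero_add]
      change (G' b).1 = 0
      rw [← h2, h1]
    -- `Φ M = (Σ_t tr(M_t B_{j,t}))_j`, `L = Φ⁻¹(b + range T)`, `π = −G ∘ Φ`
    let Φ : (Fin r → Matrix (Fin d) (Fin d) ℝ) →ₗ[ℝ] (J → ℝ) :=
      { toFun := fun M j => ∑ t, (M t * B j t).trace
        map_add' := fun M N => funext fun j => by
          simp only [Pi.add_apply, Matrix.add_mul, trace_add, Finset.sum_add_distrib]
        map_smul' := fun c M => funext fun j => by
          simp only [Pi.smul_apply, Matrix.smul_mul, trace_smul, smul_eq_mul, RingHom.id_apply,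
            Finset.mul_sum] }
    have hΦ : ∀ M j, Φ M j = ∑ t, (M t * B j t).trace := fun M j => rfl
    let Laff : AffineSubspace ℝ (Fin r → Matrix (Fin d) (Fin d) ℝ) :=
      (AffineSubspace.mk' b (LinearMap.range T)).comap Φ.toAffineMap
    have hLaff : ∀ M : Fin r → Matrix (Fin d) (Fin d) ℝ,
        M ∈ Laff ↔ ∃ y : V → ℝ, ∀ j, a j ⬝ᵥ y = (∑ t, (M t * B j t).trace) - b j := by
      intro M
      simp only [Laff, AffineSubspace.mem_comap, LinearMap.coe_toAffineMap, AffineSubspace.mem_mk',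
        vsub_eq_sub, LinearMap.mem_range]
      constructor
      · rintro ⟨y, hy⟩
        exact ⟨y, fun j => by rw [← hT, hy, Pi.sub_apply, hΦ]⟩
      · rintro ⟨y, hy⟩
        exact ⟨y, funext fun j => by rw [hT, hy, Pi.sub_apply, hΦ]⟩
    let π : (Fin r → Matrix (Fin d) (Fin d) ℝ) →ₗ[ℝ] (V → ℝ) := -(G.comp Φ)
    have hπ : ∀ M, π M = -G (Φ M) := fun M => rfl
    refine ⟨π '' {M | (∀ t, (M t).PosSemidef) ∧ M ∈ Laff}, ?_, ?_, ⟨Laff, π, rfl⟩⟩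
    · -- `P ⊆ C`: the vertices lift to the `A_i`, and `C` is convex
      refine convexHull_min ?_ ((convex_blockPsd_inter Laff).linear_image π)
      rintro _ ⟨i, rfl⟩
      have hΦA : Φ (A i) = b - T (x i) := funext fun j => by
        rw [hΦ, ← hS' i j, Pi.sub_apply, hT]
      refine ⟨A i, ⟨hA i, (hLaff _).mpr ⟨-x i, fun j => ?_⟩⟩, ?_⟩
      · rw [dotProduct_neg, ← hS' i j]
        ring
      · rw [hπ, hΦA, map_sub, hGb, hGT, zero_sub, neg_neg]
    · -- `C ⊆ Q`: `a_jᵀ π(M) = b_j − Σ_t tr(M_t B_{j,t}) ≤ b_j`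
      rintro _ ⟨M, ⟨hM, hML⟩, rfl⟩ j
      obtain ⟨y, hy⟩ := (hLaff M).mp hML
      have hΦM : Φ M = T y + b := funext fun j' => by
        rw [Pi.add_apply, hΦ, hT, hy j']
        ring
      have hπM : π M = -y := by
        rw [hπ, hΦM, map_add, hGT, hGb, add_zero]
      change a j ⬝ᵥ π M ≤ b j
      rw [hπM, dotProduct_neg, hy j]
      have : 0 ≤ ∑ t, (M t * B j t).trace := sum_nonneg fun t _ => frob_nonneg_of_posSemidef (hM t) (hB j t)
      linarith

open FixedSizePsdRank in
/-- **Gouveia–Parrilo–Thomas Thm. 2.4 / Fawzi–Parrilo Thm. 2 for `K = (S^d_+)^r` and polytopes** (`d, r ≥ 1`):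
if `P = conv{x_i : i ∈ ι} = {y : a_jᵀ y ≤ b_j ∀ j ∈ J}` (`ι` finite; two descriptions of the same polytope),
then the slack matrix `(b_j − a_jᵀ x_i)` has an `(S^d_+)^r`-factorization iff `P` has an `(S^d_+)^r`-lift —
"`P` has a `K`-lift iff its slack matrix has a `K`-factorization" for the (self-dual) cone `K = (S^d_+)^r`.
[cite: GouveiaParriloThomas2013, Thm. 2.4 (§2)] [cite: FawziParrilo2013, Thm. 2 (§2.1, p. 6) and §1.2 (p. 5)] -/
theorem hasPsdPowerFactorization_slack_iff_hasBlockPsdLift {V ι J : Type*} [Fintype V] [Finite ι]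
    {x : ι → (V → ℝ)} {a : J → (V → ℝ)} {b : J → ℝ} {d r : ℕ} (hd : 1 ≤ d) (hr : 1 ≤ r)
    (hPQ : convexHull ℝ (Set.range x) = {y | ∀ j, a j ⬝ᵥ y ≤ b j}) :
    HasPsdPowerFactorization (fun i j => b j - a j ⬝ᵥ x i) d r ↔
      HasBlockPsdLift (convexHull ℝ (Set.range x)) d r := by
  have hbdd : Bornology.IsBounded (convexHull ℝ (Set.range x)) :=
    isBounded_convexHull.2 (Set.finite_range x).isBounded
  constructor
  · intro h
    have hQ : Bornology.IsBounded {y : V → ℝ | ∀ j, a j ⬝ᵥ y ≤ b j} := by rw [← hPQ]; exact hbdd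
    obtain ⟨C, hPC, hCQ, hC⟩ := h.exists_hasBlockPsdLift_between hd hr hQ
    have hCP : C = convexHull ℝ (Set.range x) :=
      Set.Subset.antisymm (by rw [hPQ]; exact hCQ) hPC
    rwa [hCP] at hC
  · intro h
    exact h.hasPsdPowerFactorization_slack hd hr hbdd (fun i => subset_convexHull ℝ _ ⟨i, rfl⟩)
      (fun y hy j => by rw [hPQ] at hy; exact hy j)

/-- **The pair form** (FGPRT Thm. 3.3 for `P ⊆ Q` / GRT Prop. 3.6, blocks): with `Q = {y : a_jᵀy ≤ b_j}` bounded and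
containing the points `x_i` (`d, r ≥ 1`), the slack matrix `(b_j − a_jᵀx_i)` has an `(S^d_+)^r`-factorization iff
some set `C` with `conv(x_i) ⊆ C ⊆ Q` has an `(S^d_+)^r`-lift. [cite: FawziEtAl2015, Thm. 3.3 (p09–p10)]
[cite: GouveiaParriloThomas2013, Thm. 2.4 (§2)] -/
theorem FixedSizePsdRank.hasPsdPowerFactorization_slack_iff_exists_between {V ι J : Type*} [Fintype V]
    {x : ι → (V → ℝ)} {a : J → (V → ℝ)} {b : J → ℝ} {d r : ℕ} (hd : 1 ≤ d) (hr : 1 ≤ r)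
    (hxQ : ∀ i j, a j ⬝ᵥ x i ≤ b j) (hQ : Bornology.IsBounded {y : V → ℝ | ∀ j, a j ⬝ᵥ y ≤ b j}) :
    HasPsdPowerFactorization (fun i j => b j - a j ⬝ᵥ x i) d r ↔
      ∃ C : Set (V → ℝ), convexHull ℝ (Set.range x) ⊆ C ∧ C ⊆ {y | ∀ j, a j ⬝ᵥ y ≤ b j} ∧
        HasBlockPsdLift C d r := by
  constructor
  · exact fun h => h.exists_hasBlockPsdLift_between hd hr hQ
  · rintro ⟨C, hPC, hCQ, hC⟩
    have _ := hxQ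
    exact hC.hasPsdPowerFactorization_slack hd hr (hQ.subset hCQ)
      (fun i => hPC (subset_convexHull ℝ _ ⟨i, rfl⟩)) (fun y hy j => hCQ hy j)

/-- **Every polytope with finitely many vertices has an `(S^1_+)^v`-lift, `v` = number of vertices** (the
trivial LP lift through the standard simplex, "xc(P) ≤ number of vertices"): `P = G(Δ_ι)`,
`Δ_ι = ℝ^ι_+ ∩ {Σ λ_i = 1}`. [cite: GouveiaParriloThomas2013, Def. 2.2 (§2)] [cite: FawziEtAl2015, §3.1 (p09)] -/
theorem hasBlockPsdLift_convexHull_range_one {E : Type*} [AddCommGroup E] [Module ℝ E] {ι : Type*} [Fintype ι]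
    (x : ι → E) : HasBlockPsdLift (convexHull ℝ (Set.range x)) 1 (Fintype.card ι) := by
  classical
  rcases isEmpty_or_nonempty ι with hι | ⟨⟨i₀⟩⟩
  · rw [Set.range_eq_empty, convexHull_empty]
    exact hasBlockPsdLift_empty 1 _
  set r := Fintype.card ι with hr
  let e : ι ≃ Fin r := Fintype.equivFin ι
  -- `G λ = Σ λ_i x_i` and `P = G(Δ)`
  let G : (ι → ℝ) →ₗ[ℝ] E :=
    { toFun := fun lam => ∑ i, lam i • x i
      map_add' := fun l m => by simp [add_smul, Finset.sum_add_distrib]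
      map_smul' := fun c l => by simp [Finset.smul_sum, smul_smul] }
  have hG : ∀ lam, G lam = ∑ i, lam i • x i := fun lam => rfl
  have hGsingle : ∀ i, G (Pi.single i 1) = x i := fun i => by
    rw [hG, Finset.sum_eq_single i]
    · simp
    · intro j _ hji; simp [hji]
    · intro h; exact absurd (Finset.mem_univ i) h
  have hP : convexHull ℝ (Set.range x) = G '' stdSimplex ℝ ι := by
    rw [← convexHull_rangle_single_eq_stdSimplex ℝ ι, LinearMap.image_convexHull, ← Set.range_comp]
    congr 1
    ext y
    simp only [Set.mem_range, Function.comp_apply, hGsingle]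
  -- the lift: `M_t = λ_{e⁻¹ t}` as `1 × 1` blocks, `L = {Σ_t M_t = 1}`, `F(M) = Σ_t M_t x_{e⁻¹ t}`
  let τ : (Fin r → Matrix (Fin 1) (Fin 1) ℝ) →ₗ[ℝ] ℝ :=
    { toFun := fun M => ∑ t, M t 0 0
      map_add' := fun M N => by simp [Finset.sum_add_distrib]
      map_smul' := fun c M => by simp [Finset.mul_sum] }
  have hτ : ∀ M, τ M = ∑ t, M t 0 0 := fun M => rfl
  let F : (Fin r → Matrix (Fin 1) (Fin 1) ℝ) →ₗ[ℝ] E :=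
    { toFun := fun M => ∑ t, M t 0 0 • x (e.symm t)
      map_add' := fun M N => by simp [add_smul, Finset.sum_add_distrib]
      map_smul' := fun c M => by simp [Finset.smul_sum, smul_smul] }
  have hF : ∀ M, F M = ∑ t, M t 0 0 • x (e.symm t) := fun M => rfl
  let M₀ : Fin r → Matrix (Fin 1) (Fin 1) ℝ := fun t => if t = e i₀ then 1 else 0
  have hτM₀ : τ M₀ = 1 := by
    rw [hτ, Finset.sum_eq_single (e i₀)]
    · simp [M₀]
    · intro t _ ht; simp [M₀, ht]
    · intro h; exact absurd (Finset.mem_univ _) h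
  let L : AffineSubspace ℝ (Fin r → Matrix (Fin 1) (Fin 1) ℝ) := AffineSubspace.mk' M₀ (LinearMap.ker τ)
  have hL : ∀ M, M ∈ L ↔ ∑ t, M t 0 0 = 1 := by
    intro M
    rw [AffineSubspace.mem_mk', LinearMap.mem_ker, vsub_eq_sub, map_sub, hτM₀, sub_eq_zero, hτ]
  refine ⟨L, F, ?_⟩
  rw [hP]
  ext y
  constructor
  · rintro ⟨lam, ⟨hl0, hl1⟩, rfl⟩
    refine ⟨fun t => lam (e.symm t) • (1 : Matrix (Fin 1) (Fin 1) ℝ), ⟨fun t => Matrix.PosSemidef.one.smul (hl0 _),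
      (hL _).2 ?_⟩, ?_⟩
    · simp only [Matrix.smul_apply, Matrix.one_apply_eq, smul_eq_mul, mul_one]
      rw [← hl1]
      exact e.symm.sum_comp (fun i => lam i)
    · rw [hF, hG]
      simp only [Matrix.smul_apply, Matrix.one_apply_eq, smul_eq_mul, mul_one]
      exact e.symm.sum_comp (fun i => lam i • x i)
  · rintro ⟨M, ⟨hM, hML⟩, rfl⟩
    refine ⟨fun i => M (e i) 0 0, ⟨fun i => (hM (e i)).diag_nonneg, ?_⟩, ?_⟩
    · rw [← (hL M).1 hML]
      exact e.sum_comp (fun t => M t 0 0)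
    · rw [hG, hF]
      rw [← e.sum_comp (fun t => M t 0 0 • x (e.symm t))]
      simp

open FixedSizePsdRank in
/-- **Every polytope with `f` inequalities has an `(S^1_+)^f`-lift** ("xc(P) ≤ number of facets"): the slack
matrix `S` has the trivial nonnegative factorization `S = S · I_f` (`f` terms), and Gouveia–Parrilo–Thomas turns it
into a lift. [cite: GouveiaParriloThomas2013, Thm. 2.4 (§2)] [cite: FawziEtAl2015, §3.1 (p09)] -/
theorem hasBlockPsdLift_one_card_inequalities {V ι J : Type*} [Fintype V] [Finite ι] [Fintype J]
    {x : ι → (V → ℝ)} {a : J → (V → ℝ)} {b : J → ℝ}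
    (hPQ : convexHull ℝ (Set.range x) = {y | ∀ j, a j ⬝ᵥ y ≤ b j}) :
    HasBlockPsdLift (convexHull ℝ (Set.range x)) 1 (Fintype.card J) := by
  classical
  rcases isEmpty_or_nonempty J with hJ | hJ
  · -- no inequalities: `Q` is everything, so `P = conv(x_i)` is the whole (bounded!) space: only possible if
    -- `V → ℝ` is trivial; in all cases the simplex lift with `0` blocks does it when `P` is a point or empty.
    have hP : convexHull ℝ (Set.range x) = Set.univ := by
      rw [hPQ]; exact Set.eq_univ_of_forall fun y j => (IsEmpty.false j).elim
    have hbdd : Bornology.IsBounded (Set.univ : Set (V → ℝ)) := by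
      rw [← hP]; exact isBounded_convexHull.2 (Set.finite_range x).isBounded
    -- a bounded `univ` in `V → ℝ` forces `V` empty, hence `univ = {0}`
    have hV : IsEmpty V := by
      by_contra hV
      rw [not_isEmpty_iff] at hV
      obtain ⟨v⟩ := hV
      obtain ⟨R, hR⟩ := isBounded_iff_forall_norm_le.mp hbdd
      have h1 := hR (Pi.single v (R + 1)) (Set.mem_univ _)
      have h2 : ‖(Pi.single v (R + 1) : V → ℝ) v‖ ≤ ‖(Pi.single v (R + 1) : V → ℝ)‖ := norm_le_pi_norm _ v
      rw [Pi.single_eq_same, Real.norm_eq_abs] at h2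
      have h0 : 0 ≤ R := (norm_nonneg _).trans h1
      rw [abs_of_nonneg (by linarith)] at h2
      linarith
    have huniv : (Set.univ : Set (V → ℝ)) = {0} := by
      ext y; simp only [Set.mem_univ, Set.mem_singleton_iff, true_iff]
      funext v; exact (hV.false v).elim
    rw [hP, huniv, Fintype.card_eq_zero]
    -- `{0}` is the image of the one-point set `(S^1_+)^0 ∩ ⊤` under the zero map
    refine ⟨⊤, 0, ?_⟩
    ext y
    simp only [Set.mem_singleton_iff, Set.mem_image, Set.mem_setOf_eq, LinearMap.zero_apply]
    constructor
    · rintro rfl; exact ⟨fun t => t.elim0, ⟨fun t => t.elim0, AffineSubspace.mem_top ℝ _ _⟩, rfl⟩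
    · rintro ⟨_, _, rfl⟩; rfl
  have hS : HasPsdPowerFactorization (fun i j => b j - a j ⬝ᵥ x i) 1 (Fintype.card J) := by
    let e : J ≃ Fin (Fintype.card J) := Fintype.equivFin J
    refine hasPsdPowerFactorization_one_iff_nonneg.2 ⟨fun i t => b (e.symm t) - a (e.symm t) ⬝ᵥ x i,
      fun j t => if e.symm t = j then 1 else 0, fun i t => ?_, fun j t => ?_, fun i j => ?_⟩
    · have : x i ∈ convexHull ℝ (Set.range x) := subset_convexHull ℝ _ ⟨i, rfl⟩
      rw [hPQ] at this
      exact sub_nonneg.2 (this _)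
    · change (0 : ℝ) ≤ (if e.symm t = j then 1 else 0 : ℝ)
      split_ifs <;> norm_num
    · change b j - a j ⬝ᵥ x i = ∑ t, (b (e.symm t) - a (e.symm t) ⬝ᵥ x i) * (if e.symm t = j then 1 else 0 : ℝ)
      rw [Finset.sum_eq_single (e j)]
      · simp
      · intro t _ ht
        have : e.symm t ≠ j := fun h => ht (by rw [← h, Equiv.apply_symm_apply])
        simp [this]
      · intro h; exact absurd (Finset.mem_univ _) h
  exact (hasPsdPowerFactorization_slack_iff_hasBlockPsdLift le_rfl
    (Fintype.card_pos_iff.2 hJ) hPQ).1 hS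

/-- Hence a polytope with `v` vertices, resp. `f` inequalities, has a psd lift of size `v`, resp. `f`
("`rank_psd M ≤ min{p, q}`" at the level of lifts). [cite: FawziEtAl2015, Prop. 2.5 (p05) and §3.1 (p09)] -/
theorem hasPsdLift_convexHull_range_card {E : Type*} [AddCommGroup E] [Module ℝ E] {ι : Type*} [Fintype ι]
    (x : ι → E) : HasPsdLift (convexHull ℝ (Set.range x)) (Fintype.card ι) := by
  simpa using (hasBlockPsdLift_convexHull_range_one x).hasPsdLift

/-! ### `COR(n)` as a polytope in `ℝ^{n×n}` and FP13 Theorem 1 in lift form -/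

namespace FixedSizePsdRank

variable {n : ℕ}

/-- `x xᵀ ∈ ℝ^{n×n}`, flattened to `ℝ^{n²}`. [cite: FawziParrilo2013, §2.1 (p. 5, "COR(n) = conv{aaᵀ : a ∈ {0,1}ⁿ}")] -/
def vecOuter (n : ℕ) (x : Fin n → ℝ) : Fin (n * n) → ℝ :=
  fun p => x (finProdFinEquiv.symm p).1 * x (finProdFinEquiv.symm p).2

/-- The `0/1` vector of a bit string. [cite: FawziParrilo2013, §2.1 (p. 5)] -/
def bvec (a : Cube n) : Fin n → ℝ := fun i => if a i = true then 1 else 0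

/-- Entries of `bvec a` are `0` or `1`. [cite: FawziParrilo2013, §2.1 (p. 5)] -/
theorem bvec_zero_or_one (a : Cube n) (i : Fin n) : bvec a i = 0 ∨ bvec a i = 1 := by
  simp only [bvec]; split_ifs <;> simp

/-- **The correlation polytope** `COR(n) = conv{aaᵀ : a ∈ {0,1}ⁿ} ⊂ ℝ^{n×n}` (coordinates flattened to `ℝ^{n²}`).
[cite: FawziParrilo2013, §2.1 (p. 5)] -/
def corPolytope (n : ℕ) : Set (Fin (n * n) → ℝ) :=
  convexHull ℝ (Set.range fun a : Cube n => vecOuter n (bvec a))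

/-- A coefficient matrix `(c_{ij})`, flattened to `ℝ^{n²}`. [cite: FawziParrilo2013, §2.1 (p. 5)] -/
def flat (c : Matrix (Fin n) (Fin n) ℝ) : Fin (n * n) → ℝ :=
  fun p => c (finProdFinEquiv.symm p).1 (finProdFinEquiv.symm p).2

/-- `⟨c, x xᵀ⟩ = Σ_{ij} c_{ij} x_i x_j`. [cite: FawziParrilo2013, §2.1 (p. 5)] -/
theorem flat_dotProduct_vecOuter (c : Matrix (Fin n) (Fin n) ℝ) (x : Fin n → ℝ) :
    flat c ⬝ᵥ vecOuter n x = ∑ i, ∑ j, c i j * (x i * x j) := by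
  unfold flat vecOuter dotProduct
  rw [← finProdFinEquiv.sum_comp]
  simp only [Equiv.symm_apply_apply]
  rw [Fintype.sum_prod_type]

/-- `COR(n)` is bounded. [cite: FawziParrilo2013, §2.1 (p. 5)] -/
theorem isBounded_corPolytope (n : ℕ) : Bornology.IsBounded (corPolytope n) :=
  isBounded_convexHull.2 (Set.finite_range _).isBounded

/-- The vertices `x xᵀ`, `x ∈ {0,1}ⁿ`, lie in `COR(n)`. [cite: FawziParrilo2013, §2.1 (p. 5)] -/
theorem vecOuter_mem_corPolytope (pt : {x : Fin n → ℝ // ∀ i, x i = 0 ∨ x i = 1}) :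
    vecOuter n pt.1 ∈ corPolytope n := by
  classical
  refine subset_convexHull ℝ _ ⟨fun i => decide (pt.1 i = 1), ?_⟩
  change vecOuter n (bvec _) = vecOuter n pt.1
  congr 1
  funext i
  rcases pt.2 i with h | h <;> simp [bvec, h]

/-- Valid quadratic inequalities on `{0,1}ⁿ` are valid linear inequalities on `COR(n)`.
[cite: FawziParrilo2013, §2.1 (pp. 5–6)] -/
theorem flat_dotProduct_le_of_mem_corPolytope {y : Fin (n * n) → ℝ} (hy : y ∈ corPolytope n)
    (cb : {cb : Matrix (Fin n) (Fin n) ℝ × ℝ //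
      ∀ x : Fin n → ℝ, (∀ i, x i = 0 ∨ x i = 1) → ∑ i, ∑ j, cb.1 i j * (x i * x j) ≤ cb.2}) :
    flat cb.1.1 ⬝ᵥ y ≤ cb.1.2 := by
  have hlin : IsLinearMap ℝ (fun z : Fin (n * n) → ℝ => flat cb.1.1 ⬝ᵥ z) :=
    ⟨fun u v => dotProduct_add _ _ _, fun s u => dotProduct_smul s (flat cb.1.1) u⟩
  have hconv : Convex ℝ {z : Fin (n * n) → ℝ | flat cb.1.1 ⬝ᵥ z ≤ cb.1.2} := convex_halfSpace_le hlin _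
  refine (convexHull_min ?_ hconv) hy
  rintro _ ⟨a, rfl⟩
  change flat cb.1.1 ⬝ᵥ vecOuter n (bvec a) ≤ cb.1.2
  rw [flat_dotProduct_vecOuter]
  exact cb.2 (bvec a) (bvec_zero_or_one a)

/-- **An `(S^d_+)^r`-lift of `COR(n)` gives an `(S^d_+)^r`-factorization of its full slack matrix**
(`d, r ≥ 1`). [cite: FawziParrilo2013, §1.2 (p. 5, "Strategy of proof") and Thm. 2 (§2.1, p. 6)] -/
theorem hasPsdPowerFactorization_corrSlack_of_lift {n d r : ℕ} (hd : 1 ≤ d) (hr : 1 ≤ r)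
    (h : HasBlockPsdLift (corPolytope n) d r) : HasPsdPowerFactorization (corrSlack n) d r := by
  have hfac := HasBlockPsdLift.hasPsdPowerFactorization_slack
    (x := fun pt : {x : Fin n → ℝ // ∀ i, x i = 0 ∨ x i = 1} => vecOuter n pt.1)
    (a := fun cb : {cb : Matrix (Fin n) (Fin n) ℝ × ℝ //
      ∀ x : Fin n → ℝ, (∀ i, x i = 0 ∨ x i = 1) → ∑ i, ∑ j, cb.1 i j * (x i * x j) ≤ cb.2} => flat cb.1.1)
    (b := fun cb => cb.1.2) hd hr h (isBounded_corPolytope n) vecOuter_mem_corPolytope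
    (fun y hy cb => flat_dotProduct_le_of_mem_corPolytope hy cb)
  have heq : (fun (cb : {cb : Matrix (Fin n) (Fin n) ℝ × ℝ //
      ∀ x : Fin n → ℝ, (∀ i, x i = 0 ∨ x i = 1) → ∑ i, ∑ j, cb.1 i j * (x i * x j) ≤ cb.2})
      (pt : {x : Fin n → ℝ // ∀ i, x i = 0 ∨ x i = 1}) => cb.1.2 - flat cb.1.1 ⬝ᵥ vecOuter n pt.1)
      = corrSlack n := by
    funext cb pt
    rw [flat_dotProduct_vecOuter]
    rfl
  exact heq ▸ hfac.transpose

/-- `COR(n)` (`n ≥ 1`) is not a point, so it has no `(S^d_+)^0`-lift. [cite: FawziParrilo2013, §2.1 (p. 5)] -/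
theorem one_le_of_hasBlockPsdLift_corPolytope {n d r : ℕ} (hn : 1 ≤ n)
    (h : HasBlockPsdLift (corPolytope n) d r) : 1 ≤ r := by
  rcases Nat.eq_zero_or_pos r with rfl | hr
  · exfalso
    obtain ⟨L, π, hC⟩ := h
    have hsub : (corPolytope n).Subsingleton := by
      rw [hC]
      rintro _ ⟨M, -, rfl⟩ _ ⟨M', -, rfl⟩
      have : M = M' := funext fun t => t.elim0
      rw [this]
    have h0 : vecOuter n (bvec (fun _ : Fin n => false)) ∈ corPolytope n := subset_convexHull ℝ _ ⟨_, rfl⟩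
    have h1 : vecOuter n (bvec (fun _ : Fin n => true)) ∈ corPolytope n := subset_convexHull ℝ _ ⟨_, rfl⟩
    have := congrFun (hsub h0 h1) (finProdFinEquiv (⟨0, hn⟩, ⟨0, hn⟩))
    simp [vecOuter, bvec] at this
  · exact hr

end FixedSizePsdRank

open FixedSizePsdRank in
/-- **Fawzi–Parrilo 2013, Theorem 1, in lift form** (§1.2 p. 4, verbatim): "Let `d ≥ 1` be a fixed integer.
For `n ≥ d`, if `COR(n)` has a `(S^d_+)^r`-lift for some `r ∈ ℕ`, then necessarily `r ≥ κ(d)·c(d)ⁿ` where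
`c(d) = (1 − 1/3^d)^{−1/d} > 1` and `κ(d) = (3^d − 1)^{−(1−1/d)}`."  Here `COR(n) = conv{aaᵀ : a ∈ {0,1}ⁿ}`
is `corPolytope n` and an `(S^d_+)^r`-lift is `HasBlockPsdLift` (`P = π((S^d_+)^r ∩ L)`); the slack-matrix
form is `FawziParrilo2013_thm1` / `_holds`. [cite: FawziParrilo2013, Theorem 1 (§1.2, p. 4)] -/
theorem FawziParrilo2013_thm1_lift {n d r : ℕ} (hd : 1 ≤ d) (hnd : d ≤ n)
    (h : HasBlockPsdLift (corPolytope n) d r) :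
    ((3 : ℝ) ^ d - 1) ^ (-(1 - 1 / (d : ℝ))) * ((1 - 1 / (3 : ℝ) ^ d) ^ (-(1 / (d : ℝ)))) ^ n ≤ (r : ℝ) :=
  FawziParrilo2013_thm1_holds d hd n hnd r
    (hasPsdPowerFactorization_corrSlack_of_lift hd (one_le_of_hasBlockPsdLift_corPolytope (hd.trans hnd) h) h)

open FixedSizePsdRank in
/-- **FP13 Theorem 1 for second-order-cone lifts** (`d = 2`, p. 4: "`κ(2) = 1/√7`, `c(2) = √(9/7) ≈ 1.13`";
"the case `d = 2` … amounts to asking what is the smallest size of a second-order cone program needed to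
represent `COR(n)`"): an `(S²_+)^r`-lift of `COR(n)`, `n ≥ 2`, has `(1/√7)(√(9/7))ⁿ ≤ r`.
[cite: FawziParrilo2013, Thm. 1, case d = 2 (§1.2, p. 4; §2.4)] -/
theorem FawziParrilo2013_thm1_lift_two {n r : ℕ} (hn : 2 ≤ n) (h : HasBlockPsdLift (corPolytope n) 2 r) :
    1 / Real.sqrt 7 * Real.sqrt (9 / 7) ^ n ≤ (r : ℝ) :=
  FawziParrilo2013_thm1_two hn
    (hasPsdPowerFactorization_corrSlack_of_lift (by norm_num)
      (one_le_of_hasBlockPsdLift_corPolytope (by omega) h) h)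

open FixedSizePsdRank in
/-- **FP13 Theorem 1 for LP lifts** (`d = 1`: `(S^1_+)^r = ℝ^r_+`, "LP extended formulations are captured by
the case `d = 1`", p. 4): an `(S^1_+)^r`-lift of `COR(n)`, `n ≥ 1`, has `(3/2)ⁿ ≤ r` — the Fiorini et al. /
Kaibel–Weltge bound inside the FP13 framework. [cite: FawziParrilo2013, Thm. 1, case d = 1 (§1.2, p. 4)] -/
theorem FawziParrilo2013_thm1_lift_one {n r : ℕ} (hn : 1 ≤ n) (h : HasBlockPsdLift (corPolytope n) 1 r) :
    (3 / 2 : ℝ) ^ n ≤ (r : ℝ) :=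
  FawziParrilo2013_thm1_one hn
    (hasPsdPowerFactorization_corrSlack_of_lift le_rfl (one_le_of_hasBlockPsdLift_corPolytope hn h) h)

end Literature.Combinatorics.Optimization
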